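import Literature.NumberTheory.ConnesMoscovici2022.UVProlateSpectrumProofs
import Literature.Analysis.Distribution.DivFormRegularity
import Literature.Analysis.Distribution.EllipticRegularityProofs
import Literature.NumberTheory.LFunctions.ProlateEigenvalueLegendreBounds
import Literature.NumberTheory.ConnesConsani2021.ProlateProjectionsCompleteness
import Literature.NumberTheory.ConnesConsani2021.SoninTraceReduction
import Literature.NumberTheory.ConnesConsani2021.ProlateTraceIdentities
import HarnessLib

/-!
# Connes–Moscovici 2022, Corollary 2.2: even eigenvectors of `W_sa` with negative eigenvalue lie in
# Sonin's space — PROOFS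

LINE 1 — FRAMING. RH-FREE corpus literature (spectral theory of the prolate wave operator
`W = −∂(λ² − x²)∂ + (2πλx)²` on `L²(ℝ)`; sequel row of the Connes–Consani corpus, no leaf / binder
role).  bears_on: LADDER-RH W-C/W-P.  WHAT THIS IS NOT: any claim about RH; nothing in this file
mentions `RiemannHypothesis` or bears on the truth of RH.

This is the theorems-only companion of `UVProlateSpectrum.lean` (statements AS PRINTED).  It
DISCHARGES the named fact `CM22_cor_2_2` (**Corollary 2.2** of A. Connes, H. Moscovici, *The UV
prolate spectrum matches the zeros of zeta*, PNAS 119 (2022) [bib: `ConnesMoscovici2022`] =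
arXiv:2112.05500 Corollary 3.2, chunk p0008:L79–L84 of the held text `paper:arxiv-2112.05500`):

> "assume `μ` is a negative eigenvalue. Then `φ_μ` belongs to the Sonin space."  "In fact Sonin's
> space is the orthogonal of the eigenspaces of `W_sa` associated to the classical prolate functions
> and their Fourier transforms."

The tree types the corollary on the eigenvector: every a.e.-even eigenvector `φ` of a `W` with
`IsProlateSA 1 W` and eigenvalue `μ < 0` lies in `soninSpace 1 1`, i.e. (`mem_soninSpace_iff_cutoffProj`)
`P_1 φ = 0` and `P̂_1 φ = 0`.  The printed argument goes through the spectral structure of `W_sa`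
(Thm 1.6, Lemma 2.1); this file follows the elementary route behind the printed sentence "Sonin's space
is the orthogonal of the eigenspaces … associated to the classical prolate functions and their Fourier
transforms": Green's formula (1.5)–(1.6) pairs `φ` against the classical prolate functions
`ψ_n = prolateFun n` on `(−1, 1)` and against their Fourier transforms `η_n = 𝓕ξ_n` on `(1, ∞)`; the
boundary conditions (1.19) at `±1` and (1.20) at `∞` kill the boundary Wronskians, and the classical
prolate eigenvalues satisfy `χ_n > 0 > μ`, so `⟪ξ_n, φ⟫ = ⟪η_n, φ⟫ = 0` for all `n`; completeness of the
`ξ_n` (tree theorem `CC2021_sec4_xi_complete_holds`) then gives `P_1 φ = 0` and `P_1 𝓕φ = 0`.  In detail: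

* §1 `(b − x)g′ → 0 ⇒ (b − x)g → 0` (mean value inequality): with (1.19) "`(λ² − x²)∂ₓ` vanishes at
  `±λ`" this kills the boundary Wronskians at `±1`.
* §2 regularity of the boundary-condition representative `g` of `φ ∈ dom W_max`, `W_max φ = μφ`:
  the weak equation against Schwartz / real `C_c^∞` test functions
  (`integral_conj_mul_prolateWave_sub_eq_zero`, Mathlib's `LinearPMap.adjoint_isFormalAdjoint`),
  interior elliptic regularity on each component of `ℝ ∖ {±λ}` (`exists_smooth_repr_nhds`, the tree
  theorem `Literature.Analysis.Distribution.exists_contDiffOn_ae_eq_of_divForm_weak` = Folland (6.34)),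
  and the classical equation `W g = μ g` off `±λ` (`contDiffOn_repr_of_mem_prolateMax`,
  `prolateWaveOpFun_repr_eq`) — "solutions are real-analytic away from `±λ`" (§1 ¶1, Lemma 1.1 proof).
* §3 `intervalIntegral_green` — Green's formula (1.5)–(1.6) on `[a, b]` for `C²` functions on an open set.
* §4 the prolate functions `ψ_n` on `(−1, 1)`: `C²`, `W ψ_n = χ_n ψ_n` with `χ_n > 0`
  (tree theorem `IsProlateFunction.lt_eigen`), one-sided limits of `ψ_n, ψ_n′` at `±1`.
* §5 `intervalIntegral_prolateXiFun_mul_eq_zero` (`∫_{−1}^{1} ψ_n g = 0`), `inner_prolateXi_eq_zero`,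
  `cutoffProj_eq_zero_of_hasEigenvector` (**`P_1 φ = 0`**).
* §6 `η_n = 𝓕ξ_n` as a classical object on `ℝ`: the finite cosine transform of `ψ_n`
  (tree lemma `prolateEtaFun_eq_integral_cos`), `C²` (`contDiff_two_prolateEtaFun`), and `W η_n = χ_n η_n` on all
  of `ℝ` (`prolateWaveOpFun_prolateEtaFun`, from the tree theorem `IsProlateFunction.integral_mul_cos_ode`
  — Slepian's commutation).
* §7 a priori decay `|g|, |g′| ≤ C/x` on `[2, ∞)` for solutions of `W g = μ g`, `μ < 0`
  (`decay_of_prolateWave_eq`: the energy `u′² + k u²` of `u = xg` is non-increasing).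
* §8 one integration by parts in `η_n` and `η_n′` (`prolateEtaFun_eq_sin_div_add`: leading term
  `ψ_n(1) sin(2πx)/(πx)`, the paper's "`sin(2πλy)/y`"), Riemann–Lebesgue for the remainders, and the
  boundary Wronskians `[η_n, g] → 0` at `1⁺` ((1.19)) and at `+∞` ((1.20))
  (`tendsto_wronskian_prolateEtaFun_one/atTop`).
* §9 `setIntegral_Ioi_prolateEtaFun_mul_eq_zero` (`∫_{(1,∞)} η_n g = 0`), `inner_prolateEta_eq_zero`
  (`⟪η_n, φ⟫ = 0`, using `P_1 φ = 0` on `[−1, 1]` and evenness), and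
  `cutoffProjHat_eq_zero_of_hasEigenvector` (**`P̂_1 φ = 0`**, via `𝓕η_n = ξ_n`, Plancherel
  `Lp.inner_fourier_eq`, and `CC2021_sec4_xi_complete_holds` on the Fourier side).
* §10 `CM22_cor_2_2_holds : CM22_cor_2_2`.

No new definitions, no named facts: theorems only.

References: `ConnesMoscovici2022` (PNAS 119 (2022) e2123174119 = arXiv:2112.05500);
`ConnesConsani2021` (arXiv:2006.13771) §4 for `ξ_n, η_n`; Slepian–Pollak 1961 §III; Folland,
*Introduction to PDE* (1995) Cor. (6.34).
-/


open Complex Set MeasureTheory Filter Topology SchwartzMap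
open scoped Real Topology ContDiff ComplexConjugate InnerProductSpace FourierTransform

namespace Literature.NumberTheory.ConnesMoscovici2022

open Literature.NumberTheory.ConnesConsani2021 Literature.NumberTheory.ConnesConsani2024
open Literature.NumberTheory.LFunctions

/-! ## §1 Boundary behaviour forced by the condition `p g′ → 0` -/

/-- If `g` is differentiable on `(a, b)` and `(b − x) g′(x) → 0` as `x → b⁻`, then `(b − x) g(x) → 0` as
`x → b⁻` (mean value inequality on `[x₀, x]`: `|g′| ≤ ε/(b − x)` there). [folklore] -/
private theorem tendsto_sub_mul_of_deriv_left {g : ℝ → ℂ} {a b : ℝ} (hab : a < b)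
    (hg : DifferentiableOn ℝ g (Ioo a b))
    (h : Tendsto (fun x ↦ ((b - x : ℝ) : ℂ) * deriv g x) (𝓝[<] b) (𝓝 0)) :
    Tendsto (fun x ↦ ((b - x : ℝ) : ℂ) * g x) (𝓝[<] b) (𝓝 0) := by
  rw [Metric.tendsto_nhds]
  intro ε hε
  have hε2 : (0 : ℝ) < ε / 2 := by positivity
  have hev : ∀ᶠ x in 𝓝[<] b, ‖((b - x : ℝ) : ℂ) * deriv g x‖ < ε / 2 := by
    have := (Metric.tendsto_nhds.mp h) (ε / 2) hε2
    simpa only [dist_zero_right] using this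
  have hev2 : ∀ᶠ x in 𝓝[<] b, x ∈ Ioo (max a (b - 1)) b :=
    Ioo_mem_nhdsLT (max_lt hab (by linarith))
  obtain ⟨x₁, hx₁b, hsub⟩ := (mem_nhdsLT_iff_exists_Ioo_subset).mp (hev.and hev2)
  have hx₁b' : x₁ < b := hx₁b
  set x₀ : ℝ := (x₁ + b) / 2 with hx₀
  have hx₀1 : x₁ < x₀ := by rw [hx₀]; linarith
  have hx₀b : x₀ < b := by rw [hx₀]; linarith
  have hx₀mem : x₀ ∈ Ioo x₁ b := ⟨hx₀1, hx₀b⟩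
  have hx₀' := hsub hx₀mem
  have hax₀ : a < x₀ := lt_of_le_of_lt (le_max_left _ _) hx₀'.2.1
  have hbx₀ : b - 1 < x₀ := lt_of_le_of_lt (le_max_right _ _) hx₀'.2.1
  -- choose the final window
  set M : ℝ := ‖g x₀‖ + 1 with hM
  have hMpos : 0 < M := by rw [hM]; positivity
  have hδ : ∀ᶠ x in 𝓝[<] b, x ∈ Ioo (max x₀ (b - ε / (2 * M))) b :=
    Ioo_mem_nhdsLT (max_lt hx₀b (sub_lt_self b (by positivity)))
  filter_upwards [hδ] with x hx
  have hxx₀ : x₀ < x := lt_of_le_of_lt (le_max_left _ _) hx.1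
  have hxb : x < b := hx.2
  have hxε : b - x < ε / (2 * M) := by
    have := lt_of_le_of_lt (le_max_right _ _) hx.1
    linarith
  -- mean value inequality on `[x₀, x]`
  have hseg : Icc x₀ x ⊆ Ioo x₁ b := fun t ht ↦ ⟨lt_of_lt_of_le hx₀1 ht.1, lt_of_le_of_lt ht.2 hxb⟩
  have hsegab : Icc x₀ x ⊆ Ioo a b := fun t ht ↦ ⟨lt_of_lt_of_le hax₀ ht.1, lt_of_le_of_lt ht.2 hxb⟩
  have hbound : ∀ t ∈ Icc x₀ x, ‖deriv g t‖ ≤ ε / 2 / (b - x) := by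
    intro t ht
    have ht' := hsub (hseg ht)
    have h1 : ‖((b - t : ℝ) : ℂ) * deriv g t‖ < ε / 2 := ht'.1
    have hbt : 0 < b - t := by linarith [ht.2]
    rw [norm_mul, Complex.norm_real, Real.norm_eq_abs, abs_of_pos hbt] at h1
    rw [le_div_iff₀ (by linarith : (0 : ℝ) < b - x)]
    have hmono : ‖deriv g t‖ * (b - x) ≤ ‖deriv g t‖ * (b - t) :=
      mul_le_mul_of_nonneg_left (by linarith [ht.2]) (norm_nonneg _)
    nlinarith
  have hdiff : ∀ t ∈ Icc x₀ x, DifferentiableAt ℝ g t :=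
    fun t ht ↦ hg.differentiableAt (isOpen_Ioo.mem_nhds (hsegab ht))
  have hmv := (convex_Icc x₀ x).norm_image_sub_le_of_norm_deriv_le hdiff hbound
    (left_mem_Icc.mpr hxx₀.le) (right_mem_Icc.mpr hxx₀.le)
  -- assemble
  rw [dist_zero_right, norm_mul, Complex.norm_real, Real.norm_eq_abs, abs_of_pos (by linarith)]
  have hgx : ‖g x‖ ≤ ‖g x₀‖ + ε / 2 / (b - x) * (x - x₀) := by
    have := norm_le_norm_add_norm_sub' (g x) (g x₀)
    rw [Real.norm_eq_abs, abs_of_pos (by linarith)] at hmv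
    linarith
  have hx1 : x - x₀ ≤ 1 := by linarith
  calc (b - x) * ‖g x‖ ≤ (b - x) * (‖g x₀‖ + ε / 2 / (b - x) * (x - x₀)) :=
        mul_le_mul_of_nonneg_left hgx (by linarith)
    _ = (b - x) * ‖g x₀‖ + ε / 2 * (x - x₀) := by
        have hbx : b - x ≠ 0 := by linarith
        field_simp
    _ < ε / (2 * M) * M + ε / 2 * 1 := by
        have h1 : (b - x) * ‖g x₀‖ < ε / (2 * M) * M := by
          have : ‖g x₀‖ < M := by rw [hM]; linarith
          calc (b - x) * ‖g x₀‖ ≤ (b - x) * M :=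
                mul_le_mul_of_nonneg_left this.le (by linarith)
            _ < ε / (2 * M) * M := mul_lt_mul_of_pos_right hxε hMpos
        have h2 : ε / 2 * (x - x₀) ≤ ε / 2 * 1 := mul_le_mul_of_nonneg_left hx1 hε2.le
        linarith
    _ = ε := by field_simp; ring

/-- Mirror image: if `g` is differentiable on `(a, b)` and `(x − a) g′(x) → 0` as `x → a⁺`, then
`(x − a) g(x) → 0` as `x → a⁺`. [folklore] -/
private theorem tendsto_sub_mul_of_deriv_right {g : ℝ → ℂ} {a b : ℝ} (hab : a < b)
    (hg : DifferentiableOn ℝ g (Ioo a b))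
    (h : Tendsto (fun x ↦ ((x - a : ℝ) : ℂ) * deriv g x) (𝓝[>] a) (𝓝 0)) :
    Tendsto (fun x ↦ ((x - a : ℝ) : ℂ) * g x) (𝓝[>] a) (𝓝 0) := by
  -- reduce to the left version through `x ↦ −x`
  set G : ℝ → ℂ := fun y ↦ g (-y) with hG
  have hG' : DifferentiableOn ℝ G (Ioo (-b) (-a)) := by
    intro y hy
    have hy' : -y ∈ Ioo a b := ⟨by linarith [hy.2], by linarith [hy.1]⟩
    exact ((hg.differentiableAt (isOpen_Ioo.mem_nhds hy')).comp y
      (differentiable_neg y)).differentiableWithinAt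
  have hderiv : ∀ y ∈ Ioo (-b) (-a), deriv G y = -deriv g (-y) := by
    intro y hy
    have hy' : -y ∈ Ioo a b := ⟨by linarith [hy.2], by linarith [hy.1]⟩
    have hd := hg.differentiableAt (isOpen_Ioo.mem_nhds hy')
    have hc : HasDerivAt (g ∘ Neg.neg) ((-1 : ℝ) • deriv g (-y)) y :=
      HasDerivAt.scomp y hd.hasDerivAt (hasDerivAt_neg y)
    rw [hG]
    change deriv (g ∘ Neg.neg) y = -deriv g (-y)
    rw [hc.deriv, neg_one_smul]
  have hmap : Tendsto (fun y : ℝ ↦ -y) (𝓝[<] (-a)) (𝓝[>] a) := by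
    have h1 : Tendsto (fun y : ℝ ↦ -y) (𝓝 (-a)) (𝓝 a) := by
      simpa using (continuous_neg.tendsto (-a))
    refine h1.inf ?_
    rw [tendsto_principal_principal]
    intro y hy
    simp only [mem_Iio] at hy
    simp only [mem_Ioi]; linarith
  have hL : Tendsto (fun y ↦ ((-a - y : ℝ) : ℂ) * deriv G y) (𝓝[<] (-a)) (𝓝 0) := by
    have h2 := h.comp hmap
    have hev : ∀ᶠ y in 𝓝[<] (-a), y ∈ Ioo (-b) (-a) := Ioo_mem_nhdsLT (by linarith)
    have h3 : Tendsto (fun y ↦ -(((-y - a : ℝ) : ℂ) * deriv g (-y))) (𝓝[<] (-a)) (𝓝 0) := by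
      simpa using h2.neg
    refine h3.congr' ?_
    filter_upwards [hev] with y hy
    rw [hderiv y hy]
    push_cast; ring
  have hres := tendsto_sub_mul_of_deriv_left (by linarith : -b < -a) hG' hL
  -- transport back
  have hmap' : Tendsto (fun x : ℝ ↦ -x) (𝓝[>] a) (𝓝[<] (-a)) := by
    have h1 : Tendsto (fun x : ℝ ↦ -x) (𝓝 a) (𝓝 (-a)) := (continuous_neg.tendsto a)
    refine h1.inf ?_
    rw [tendsto_principal_principal]
    intro y hy
    simp only [mem_Ioi] at hy
    simp only [mem_Iio]; linarith
  have h3 := hres.comp hmap'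
  refine (tendsto_congr ?_).mp h3
  intro x
  simp only [Function.comp_apply, hG, neg_neg]
  push_cast; ring

/-! ## §3 The Lagrange identity and Green's formula, local version -/

/-- `p = λ² − x²` is smooth. [folklore] -/
private theorem contDiff_pCoeff' (lam : ℝ) (n : WithTop ℕ∞) : ContDiff ℝ n (pCoeff lam) := by
  have h : ContDiff ℝ n (fun x : ℝ ↦ lam ^ 2 - x ^ 2) := by fun_prop
  exact (Complex.ofRealCLM.contDiff.of_le le_top).comp h

/-- **Lagrange identity, local form**: for `f, g` of class `C²` on an open set `U` and `x ∈ U`,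
`d/dx [f, g] = g·Wf − f·Wg` at `x`. [cite: ConnesMoscovici2022, §1 eqs. (1.5)–(1.6) (= arXiv (2.5)–(2.6), chunk p0005:L31–L40)] -/
theorem hasDerivAt_wronskian_of_contDiffOn (lam : ℝ) {U : Set ℝ} (hU : IsOpen U) {f g : ℝ → ℂ}
    (hf : ContDiffOn ℝ 2 f U) (hg : ContDiffOn ℝ 2 g U) {x : ℝ} (hx : x ∈ U) :
    HasDerivAt (wronskian lam f g)
      (g x * prolateWaveOpFun lam f x - f x * prolateWaveOpFun lam g x) x := by
  have hxU : U ∈ 𝓝 x := hU.mem_nhds hx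
  have hf1 : DifferentiableAt ℝ f x := (hf.contDiffAt hxU).differentiableAt (by norm_num)
  have hg1 : DifferentiableAt ℝ g x := (hg.contDiffAt hxU).differentiableAt (by norm_num)
  have hf2' : ContDiffOn ℝ 1 (deriv f) U := hf.deriv_of_isOpen hU (by norm_num)
  have hg2' : ContDiffOn ℝ 1 (deriv g) U := hg.deriv_of_isOpen hU (by norm_num)
  have hf2 : DifferentiableAt ℝ (deriv f) x := (hf2'.contDiffAt hxU).differentiableAt one_ne_zero
  have hg2 : DifferentiableAt ℝ (deriv g) x := (hg2'.contDiffAt hxU).differentiableAt one_ne_zero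
  have hp : DifferentiableAt ℝ (pCoeff lam) x := ((contDiff_pCoeff' lam 1).differentiable one_ne_zero) x
  have hA : HasDerivAt (fun y ↦ pCoeff lam y * deriv g y)
      (deriv (fun y ↦ pCoeff lam y * deriv g y) x) x := (hp.mul hg2).hasDerivAt
  have hB : HasDerivAt (fun y ↦ pCoeff lam y * deriv f y)
      (deriv (fun y ↦ pCoeff lam y * deriv f y) x) x := (hp.mul hf2).hasDerivAt
  have hW : wronskian lam f g =
      fun y ↦ f y * (pCoeff lam y * deriv g y) - g y * (pCoeff lam y * deriv f y) := by
    funext y; simp only [wronskian]; ring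
  rw [hW]
  have h := (hf1.hasDerivAt.mul hA).sub (hg1.hasDerivAt.mul hB)
  refine h.congr_deriv ?_
  have eP : (fun y ↦ ((lam ^ 2 - y ^ 2 : ℝ) : ℂ) * deriv g y) = fun y ↦ pCoeff lam y * deriv g y := by
    funext y; rfl
  have eP' : (fun y ↦ ((lam ^ 2 - y ^ 2 : ℝ) : ℂ) * deriv f y) = fun y ↦ pCoeff lam y * deriv f y := by
    funext y; rfl
  simp only [prolateWaveOpFun, eP, eP']
  ring

/-- `W f` is continuous on an open set where `f` is `C²`. [folklore] -/
private theorem continuousOn_prolateWaveOpFun (lam : ℝ) {U : Set ℝ} (hU : IsOpen U) {f : ℝ → ℂ}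
    (hf : ContDiffOn ℝ 2 f U) : ContinuousOn (prolateWaveOpFun lam f) U := by
  have hf2 : ContDiffOn ℝ 1 (deriv f) U := hf.deriv_of_isOpen hU (by norm_num)
  have hPf : ContDiffOn ℝ 1 (fun y ↦ ((lam ^ 2 - y ^ 2 : ℝ) : ℂ) * deriv f y) U :=
    ((contDiff_pCoeff' lam 1).contDiffOn).mul hf2
  have h1 : ContinuousOn (deriv fun y ↦ ((lam ^ 2 - y ^ 2 : ℝ) : ℂ) * deriv f y) U :=
    hPf.continuousOn_deriv_of_isOpen hU le_rfl
  have h2 : ContinuousOn f U := hf.continuousOn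
  have h3 : Continuous fun x : ℝ ↦ ((2 * π * lam * x : ℝ) : ℂ) ^ 2 := by fun_prop
  unfold prolateWaveOpFun
  exact (h1.neg).add (h3.continuousOn.mul h2)

/-- **Green's formula on `[a, b]`, local form**: for `f, g ∈ C²(U)`, `U` open, `[a, b] ⊆ U`:
`∫_a^b (g·Wf − f·Wg) = [f, g](b) − [f, g](a)`. [cite: ConnesMoscovici2022, §1 eqs. (1.5)–(1.6) (= arXiv (2.5)–(2.6), chunk p0005:L31–L40)] -/
theorem intervalIntegral_green (lam : ℝ) {U : Set ℝ} (hU : IsOpen U) {f g : ℝ → ℂ}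
    (hf : ContDiffOn ℝ 2 f U) (hg : ContDiffOn ℝ 2 g U) {a b : ℝ} (hab : uIcc a b ⊆ U) :
    ∫ x in a..b, (g x * prolateWaveOpFun lam f x - f x * prolateWaveOpFun lam g x) =
      wronskian lam f g b - wronskian lam f g a := by
  have hcont : ContinuousOn
      (fun x ↦ g x * prolateWaveOpFun lam f x - f x * prolateWaveOpFun lam g x) (uIcc a b) :=
    ((hg.continuousOn.mul (continuousOn_prolateWaveOpFun lam hU hf)).sub
      (hf.continuousOn.mul (continuousOn_prolateWaveOpFun lam hU hg))).mono hab
  exact intervalIntegral.integral_eq_sub_of_hasDerivAt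
    (fun x hx ↦ hasDerivAt_wronskian_of_contDiffOn lam hU hf hg (hab hx))
    (hcont.intervalIntegrable)

/-! ## §2a The operator on real test functions; the weak eigen-equation -/

/-- On a real `C²` function the complex prolate wave operator is the real one (`prolateOp`), cast. [folklore] -/
private theorem prolateWaveOpFun_ofReal (lam : ℝ) {ρ : ℝ → ℝ} (hρ : ContDiff ℝ 2 ρ) (x : ℝ) :
    prolateWaveOpFun lam (fun y ↦ (ρ y : ℂ)) x = ((prolateOp lam ρ x : ℝ) : ℂ) := by
  have hρ1 : Differentiable ℝ ρ := hρ.differentiable (by norm_num)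
  have hρ2 : Differentiable ℝ (deriv ρ) := hρ.differentiable_deriv_two
  have hd1 : deriv (fun y ↦ (ρ y : ℂ)) = fun y ↦ ((deriv ρ y : ℝ) : ℂ) := by
    funext y
    exact ((hρ1 y).hasDerivAt.ofReal_comp).deriv
  have hin : (fun y ↦ ((lam ^ 2 - y ^ 2 : ℝ) : ℂ) * deriv (fun y ↦ (ρ y : ℂ)) y) =
      fun y ↦ (((lam ^ 2 - y ^ 2) * deriv ρ y : ℝ) : ℂ) := by
    rw [hd1]; funext y; push_cast; ring
  have hdin : Differentiable ℝ (fun y ↦ (lam ^ 2 - y ^ 2) * deriv ρ y) := by fun_prop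
  have hd2 : deriv (fun y ↦ (((lam ^ 2 - y ^ 2) * deriv ρ y : ℝ) : ℂ)) x =
      ((deriv (fun y ↦ (lam ^ 2 - y ^ 2) * deriv ρ y) x : ℝ) : ℂ) :=
    ((hdin x).hasDerivAt.ofReal_comp).deriv
  rw [prolateWaveOpFun, hin, hd2, prolateOp]
  push_cast; ring

/-- Unfolding `schwartzToL2`. [folklore] -/
private theorem schwartzToL2_eq (f : 𝓢(ℝ, ℂ)) : schwartzToL2 f = f.toLp 2 volume := rfl

/-- **The weak eigen-equation** of a `W_max`-eigenvector against Schwartz test functions: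
`∫ conj(φ)·(Wf − μf) = 0` ("`dom(W_max) = {ξ ∈ L² | Wξ ∈ L²}` with `Wξ` viewed as a tempered
distribution"). [cite: ConnesMoscovici2022, §1 ¶1 and eq. (1.2) (= arXiv §2 ¶1, (2.2), chunk p0004:L16–L22)] -/
theorem integral_conj_mul_prolateWave_sub_eq_zero (lam : ℝ) {φ : L2R}
    (hφ : φ ∈ (prolateMax lam).domain) {μ : ℝ} (hW : prolateMax lam ⟨φ, hφ⟩ = (μ : ℂ) • φ)
    (f : 𝓢(ℝ, ℂ)) :
    ∫ x, conj ((φ : ℝ → ℂ) x) * (prolateWaveOpFun lam f x - μ * f x) = 0 := by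
  have hform := LinearPMap.adjoint_isFormalAdjoint (T := prolateCore lam) dense_schwartzL2
  have key := hform ⟨φ, hφ⟩ ⟨schwartzToL2 f, LinearMap.mem_range_self _ f⟩
  -- `key : ⟪W_max φ, f⟫ = ⟪φ, W f⟫`
  change ⟪prolateMax lam ⟨φ, hφ⟩, schwartzToL2 f⟫_ℂ =
    ⟪φ, prolateCore lam ⟨schwartzToL2 f, LinearMap.mem_range_self _ f⟩⟫_ℂ at key
  rw [hW, prolateCore_apply, inner_smul_left, Complex.conj_ofReal, schwartzToL2_eq,
    schwartzToL2_eq] at key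
  -- as integrals
  rw [L2.inner_def, L2.inner_def] at key
  have h1 : ∫ a : ℝ, ⟪(φ : ℝ → ℂ) a, ((f.toLp 2 volume : L2R) : ℝ → ℂ) a⟫_ℂ =
      ∫ a : ℝ, conj ((φ : ℝ → ℂ) a) * f a := by
    refine integral_congr_ae ?_
    filter_upwards [f.coeFn_toLp 2 volume] with a ha
    rw [ha, RCLike.inner_apply, mul_comm]
  have h2 : ∫ a : ℝ, ⟪(φ : ℝ → ℂ) a, (((prolateSchwartz lam f).toLp 2 volume : L2R) : ℝ → ℂ) a⟫_ℂ =
      ∫ a : ℝ, conj ((φ : ℝ → ℂ) a) * prolateWaveOpFun lam f a := by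
    refine integral_congr_ae ?_
    filter_upwards [(prolateSchwartz lam f).coeFn_toLp 2 volume] with a ha
    rw [ha, RCLike.inner_apply, prolateSchwartz_apply, mul_comm]
  rw [h1, h2] at key
  -- integrability (both are `L²` inner products)
  have hi1 : Integrable (fun a : ℝ ↦ conj ((φ : ℝ → ℂ) a) * f a) := by
    refine (L2.integrable_inner φ (f.toLp 2 volume)).congr ?_
    filter_upwards [f.coeFn_toLp 2 volume] with a ha
    rw [ha, RCLike.inner_apply, mul_comm]
  have hi2 : Integrable (fun a : ℝ ↦ conj ((φ : ℝ → ℂ) a) * prolateWaveOpFun lam f a) := by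
    refine (L2.integrable_inner φ ((prolateSchwartz lam f).toLp 2 volume)).congr ?_
    filter_upwards [(prolateSchwartz lam f).coeFn_toLp 2 volume] with a ha
    rw [ha, RCLike.inner_apply, prolateSchwartz_apply, mul_comm]
  have : ∫ x, conj ((φ : ℝ → ℂ) x) * (prolateWaveOpFun lam f x - μ * f x) =
      (∫ a : ℝ, conj ((φ : ℝ → ℂ) a) * prolateWaveOpFun lam f a) -
        μ * ∫ a : ℝ, conj ((φ : ℝ → ℂ) a) * f a := by
    rw [← integral_const_mul, ← integral_sub hi2 (hi1.const_mul _)]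
    congr 1; funext x; ring
  rw [this, ← key, sub_self]

/-- A real smooth compactly supported function is (the real part of) a complex Schwartz
function. [folklore] -/
private theorem exists_schwartz_eq_ofReal {ρ : ℝ → ℝ} (hρs : ContDiff ℝ ∞ ρ) (hρc : HasCompactSupport ρ) :
    ∃ f : 𝓢(ℝ, ℂ), ∀ x, f x = (ρ x : ℂ) :=
  ⟨(hρc.comp_left Complex.ofReal_zero).toSchwartzMap (Complex.ofRealCLM.contDiff.comp hρs),
    fun _ ↦ rfl⟩

/-- **Weak eigen-equation, real test functions**: for `ρ ∈ C_c^∞(ℝ)` real,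
`∫ conj(φ)·(Lρ − μρ) = 0` with the REAL operator `L = prolateOp λ`. [cite: ConnesMoscovici2022, §1 eq. (1.2) (= arXiv (2.2), chunk p0004:L16–L22)] -/
theorem integral_conj_mul_prolateOp_sub_eq_zero (lam : ℝ) {φ : L2R}
    (hφ : φ ∈ (prolateMax lam).domain) {μ : ℝ} (hW : prolateMax lam ⟨φ, hφ⟩ = (μ : ℂ) • φ)
    {ρ : ℝ → ℝ} (hρs : ContDiff ℝ ∞ ρ) (hρc : HasCompactSupport ρ) :
    ∫ x, conj ((φ : ℝ → ℂ) x) * (((prolateOp lam ρ x - μ * ρ x : ℝ) : ℂ)) = 0 := by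
  obtain ⟨f, hf⟩ := exists_schwartz_eq_ofReal hρs hρc
  have h := integral_conj_mul_prolateWave_sub_eq_zero lam hφ hW f
  have hρ2 : ContDiff ℝ 2 ρ := hρs.of_le (by norm_cast)
  have hfun : (fun x ↦ conj ((φ : ℝ → ℂ) x) * (prolateWaveOpFun lam f x - μ * f x)) =
      fun x ↦ conj ((φ : ℝ → ℂ) x) * (((prolateOp lam ρ x - μ * ρ x : ℝ) : ℂ)) := by
    have hW' : ∀ x, prolateWaveOpFun lam f x = ((prolateOp lam ρ x : ℝ) : ℂ) := fun x ↦ by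
      have : ((f : 𝓢(ℝ, ℂ)) : ℝ → ℂ) = fun y ↦ (ρ y : ℂ) := funext hf
      rw [this]; exact prolateWaveOpFun_ofReal lam hρ2 x
    funext x
    simp only [hW' x, hf x, Complex.ofReal_sub, Complex.ofReal_mul]
  rwa [hfun] at h

/-- Integrability of `conj(φ)·r` for `φ ∈ L²` and a real Schwartz-class `r` (here: `Lρ − μρ`). [folklore] -/
private theorem integrable_conj_mul_ofReal (lam : ℝ) (φ : L2R) (μ : ℝ)
    {ρ : ℝ → ℝ} (hρs : ContDiff ℝ ∞ ρ) (hρc : HasCompactSupport ρ) :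
    Integrable (fun x ↦ conj ((φ : ℝ → ℂ) x) * (((prolateOp lam ρ x - μ * ρ x : ℝ) : ℂ))) := by
  obtain ⟨f₀, hf₀⟩ := exists_schwartz_eq_ofReal hρs hρc
  set f : 𝓢(ℝ, ℂ) := prolateSchwartz lam f₀ - (μ : ℂ) • f₀ with hf
  have hρ2 : ContDiff ℝ 2 ρ := hρs.of_le (by norm_cast)
  have hfx : ∀ x, f x = (((prolateOp lam ρ x - μ * ρ x : ℝ) : ℂ)) := by
    intro x
    have hW' : prolateWaveOpFun lam f₀ x = ((prolateOp lam ρ x : ℝ) : ℂ) := by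
      have : ((f₀ : 𝓢(ℝ, ℂ)) : ℝ → ℂ) = fun y ↦ (ρ y : ℂ) := funext hf₀
      rw [this]; exact prolateWaveOpFun_ofReal lam hρ2 x
    rw [hf, sub_apply, smul_apply, prolateSchwartz_apply, hW', smul_eq_mul, hf₀ x,
      Complex.ofReal_sub, Complex.ofReal_mul]
  refine (L2.integrable_inner φ (f.toLp 2 volume)).congr ?_
  filter_upwards [f.coeFn_toLp 2 volume] with a ha
  rw [ha, RCLike.inner_apply, hfx, mul_comm]

/-- **Weak eigen-equation for the real and imaginary parts** (the real operator is applied to a real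
test function, so the identity splits). [cite: ConnesMoscovici2022, §1 eq. (1.2) (= arXiv (2.2), chunk p0004:L16–L22)] -/
theorem integral_re_im_mul_prolateOp_sub_eq_zero (lam : ℝ) {φ : L2R}
    (hφ : φ ∈ (prolateMax lam).domain) {μ : ℝ} (hW : prolateMax lam ⟨φ, hφ⟩ = (μ : ℂ) • φ)
    {ρ : ℝ → ℝ} (hρs : ContDiff ℝ ∞ ρ) (hρc : HasCompactSupport ρ) :
    (∫ x, ((φ : ℝ → ℂ) x).re * (prolateOp lam ρ x - μ * ρ x) = 0) ∧
      ∫ x, ((φ : ℝ → ℂ) x).im * (prolateOp lam ρ x - μ * ρ x) = 0 := by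
  have h := integral_conj_mul_prolateOp_sub_eq_zero lam hφ hW hρs hρc
  have hi := integrable_conj_mul_ofReal lam φ μ hρs hρc
  have hre := integral_re hi
  have him := integral_im hi
  rw [h] at hre him
  simp only [RCLike.re_to_complex, RCLike.im_to_complex, Complex.zero_re, Complex.zero_im,
    Complex.mul_re, Complex.mul_im, Complex.conj_re, Complex.conj_im, Complex.ofReal_re,
    Complex.ofReal_im, mul_zero, sub_zero, zero_add] at hre him
  refine ⟨hre, ?_⟩
  have : ∫ x, -(((φ : ℝ → ℂ) x).im * (prolateOp lam ρ x - μ * ρ x)) = 0 := by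
    simpa [neg_mul] using him
  rwa [integral_neg, neg_eq_zero] at this


/-! ## §2b Local smoothness off `±λ` (elliptic regularity, the tree's Folland (6.34)) -/

/-- `p = λ² − x²` vanishes off the test function's support: the real operator `L` kills points outside
`tsupport ρ`. [folklore] -/
private theorem prolateOp_eq_zero_of_notMem_tsupport (lam : ℝ) {ρ : ℝ → ℝ} {x : ℝ} (hx : x ∉ tsupport ρ) :
    prolateOp lam ρ x = 0 := by
  have h0 : ρ =ᶠ[𝓝 x] (fun _ ↦ (0 : ℝ)) := notMem_tsupport_iff_eventuallyEq.mp hx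
  have h1 : deriv ρ =ᶠ[𝓝 x] (fun _ ↦ (0 : ℝ)) := by
    have := h0.deriv; simpa using this
  have h2 : (fun y ↦ (lam ^ 2 - y ^ 2) * deriv ρ y) =ᶠ[𝓝 x] (fun _ ↦ (0 : ℝ)) := by
    filter_upwards [h1] with y hy; simp [hy]
  have h3 : deriv (fun y ↦ (lam ^ 2 - y ^ 2) * deriv ρ y) x = 0 := by
    rw [h2.deriv_eq]; simp
  rw [prolateOp, h3, h0.eq_of_nhds]; simp

/-- **Interior regularity on a component of `ℝ ∖ {±λ}`**: on an open set `Ω` where `σ·(λ² − x²) > 0`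
(`σ = ±1`), a `W_max`-eigenvector for a real eigenvalue is, near each point, a.e. equal to a `C^∞`
function (the equation is elliptic there; tree theorem `exists_contDiffOn_ae_eq_of_divForm_weak` fed by
`Folland1995_cor634_holds`). [cite: ConnesMoscovici2022, §1 ¶1 (= arXiv §2 ¶1, chunk p0004:L16–L22)] -/
theorem exists_smooth_repr_nhds (lam : ℝ) {φ : L2R} (hφ : φ ∈ (prolateMax lam).domain) {μ : ℝ}
    (hW : prolateMax lam ⟨φ, hφ⟩ = (μ : ℂ) • φ) {Ω : Set ℝ} (hΩ : IsOpen Ω) {σ : ℝ}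
    (hpos : ∀ x ∈ Ω, 0 < σ * (lam ^ 2 - x ^ 2)) {x₀ : ℝ} (hx₀ : x₀ ∈ Ω) :
    ∃ U : Set ℝ, IsOpen U ∧ x₀ ∈ U ∧ U ⊆ Ω ∧
      ∃ w : ℝ → ℂ, ContDiffOn ℝ ∞ w U ∧ ∀ᵐ x, x ∈ U → (φ : ℝ → ℂ) x = w x := by
  classical
  -- the divergence-form data
  set a : Fin 1 → Fin 1 → ℝ → ℝ := fun _ _ y ↦ σ * (lam ^ 2 - y ^ 2) with ha_def
  set c : ℝ → ℝ := fun y ↦ σ * ((2 * π * lam * y) ^ 2 - μ) with hc_def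
  set b : Module.Basis (Fin 1) ℝ ℝ := Module.Basis.singleton (Fin 1) ℝ with hb_def
  have ha : ∀ i j, ContDiffOn ℝ ∞ (a i j) Ω := fun _ _ ↦ by
    rw [ha_def]; exact (by fun_prop : ContDiff ℝ ∞ fun y : ℝ ↦ σ * (lam ^ 2 - y ^ 2)).contDiffOn
  have hc : ContDiffOn ℝ ∞ c Ω := by
    rw [hc_def]; exact (by fun_prop : ContDiff ℝ ∞ fun y : ℝ ↦ σ * ((2 * π * lam * y) ^ 2 - μ)).contDiffOn
  have hG : ContDiffOn ℝ ∞ (fun _ : ℝ ↦ (0 : ℝ)) Ω := contDiffOn_const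
  have hposM : ∀ x ∈ Ω, ∀ v : Fin 1 → ℝ, v ≠ 0 → 0 < ∑ i, ∑ j, a i j x * (v i * v j) := by
    intro x hx v hv
    have hv0 : v 0 ≠ 0 := by
      intro h; apply hv; funext i; rw [Subsingleton.elim i 0, h]; rfl
    simp only [Fin.sum_univ_one, ha_def]
    exact mul_pos (hpos x hx) (mul_self_pos.mpr hv0)
  -- the divergence-form integrand is `−σ·(Lψ − μψ)`
  have hint : ∀ (ψ : ℝ → ℝ), ContDiff ℝ ∞ ψ → ∀ x,
      ((∑ i, ∑ j, fderiv ℝ (fun y ↦ a i j y * fderiv ℝ ψ y (b i)) x (b j)) - c x * ψ x) =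
        -σ * (prolateOp lam ψ x - μ * ψ x) := by
    intro ψ hψ x
    have hψ2 : Differentiable ℝ (deriv ψ) := (hψ.of_le (by norm_cast)).differentiable_deriv_two
    simp only [Fin.sum_univ_one, hb_def, Module.Basis.singleton_apply, fderiv_apply_one_eq_deriv,
      ha_def, hc_def]
    have h1 : (fun y ↦ σ * (lam ^ 2 - y ^ 2) * deriv ψ y) =
        fun y ↦ σ * ((lam ^ 2 - y ^ 2) * deriv ψ y) := by funext y; ring
    rw [h1, deriv_const_mul_field, prolateOp]
    ring
  obtain ⟨hre, him⟩ := fun (ψ : ℝ → ℝ) (h1 : ContDiff ℝ ∞ ψ) (h2 : HasCompactSupport ψ) ↦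
    integral_re_im_mul_prolateOp_sub_eq_zero lam hφ hW h1 h2, trivial
  -- local integrability of the real and imaginary parts
  have hL2 : MemLp (φ : ℝ → ℂ) 2 volume := Lp.memLp φ
  have hu_re : LocallyIntegrableOn (fun x ↦ ((φ : ℝ → ℂ) x).re) Ω volume :=
    ((hL2.re).locallyIntegrable (by norm_num)).locallyIntegrableOn Ω
  have hu_im : LocallyIntegrableOn (fun x ↦ ((φ : ℝ → ℂ) x).im) Ω volume :=
    ((hL2.im).locallyIntegrable (by norm_num)).locallyIntegrableOn Ω
  have hweak_re : ∀ ψ : ℝ → ℝ, ContDiff ℝ ∞ ψ → HasCompactSupport ψ → tsupport ψ ⊆ Ω →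
      ∫ x, ((φ : ℝ → ℂ) x).re *
        ((∑ i, ∑ j, fderiv ℝ (fun y ↦ a i j y * fderiv ℝ ψ y (b i)) x (b j)) - c x * ψ x) =
        ∫ x, (0 : ℝ) * ψ x := by
    intro ψ h1 h2 _
    simp only [hint ψ h1, zero_mul, integral_zero]
    have := (integral_re_im_mul_prolateOp_sub_eq_zero lam hφ hW h1 h2).1
    have hmul : (fun x ↦ ((φ : ℝ → ℂ) x).re * (-σ * (prolateOp lam ψ x - μ * ψ x))) =
        fun x ↦ (-σ) * (((φ : ℝ → ℂ) x).re * (prolateOp lam ψ x - μ * ψ x)) := by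
      funext x; ring
    rw [hmul, integral_const_mul, this, mul_zero]
  have hweak_im : ∀ ψ : ℝ → ℝ, ContDiff ℝ ∞ ψ → HasCompactSupport ψ → tsupport ψ ⊆ Ω →
      ∫ x, ((φ : ℝ → ℂ) x).im *
        ((∑ i, ∑ j, fderiv ℝ (fun y ↦ a i j y * fderiv ℝ ψ y (b i)) x (b j)) - c x * ψ x) =
        ∫ x, (0 : ℝ) * ψ x := by
    intro ψ h1 h2 _
    simp only [hint ψ h1, zero_mul, integral_zero]
    have := (integral_re_im_mul_prolateOp_sub_eq_zero lam hφ hW h1 h2).2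
    have hmul : (fun x ↦ ((φ : ℝ → ℂ) x).im * (-σ * (prolateOp lam ψ x - μ * ψ x))) =
        fun x ↦ (-σ) * (((φ : ℝ → ℂ) x).im * (prolateOp lam ψ x - μ * ψ x)) := by
      funext x; ring
    rw [hmul, integral_const_mul, this, mul_zero]
  obtain ⟨U₁, hU₁o, hx₁, hU₁Ω, w₁, hw₁, hae₁⟩ :=
    Literature.Analysis.Distribution.exists_contDiffOn_ae_eq_of_divForm_weak (volume : Measure ℝ) b
      Literature.Analysis.Distribution.Folland1995_cor634_holds hΩ ha hposM hc hG hu_re hweak_re hx₀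
  obtain ⟨U₂, hU₂o, hx₂, hU₂Ω, w₂, hw₂, hae₂⟩ :=
    Literature.Analysis.Distribution.exists_contDiffOn_ae_eq_of_divForm_weak (volume : Measure ℝ) b
      Literature.Analysis.Distribution.Folland1995_cor634_holds hΩ ha hposM hc hG hu_im hweak_im hx₀
  refine ⟨U₁ ∩ U₂, hU₁o.inter hU₂o, ⟨hx₁, hx₂⟩, fun x hx ↦ hU₁Ω hx.1,
    fun x ↦ (w₁ x : ℂ) + (w₂ x : ℂ) * I, ?_, ?_⟩
  · have h1 : ContDiffOn ℝ ∞ (fun x ↦ (w₁ x : ℂ)) (U₁ ∩ U₂) :=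
      (Complex.ofRealCLM.contDiff.comp_contDiffOn hw₁).mono inter_subset_left
    have h2 : ContDiffOn ℝ ∞ (fun x ↦ (w₂ x : ℂ)) (U₁ ∩ U₂) :=
      (Complex.ofRealCLM.contDiff.comp_contDiffOn hw₂).mono inter_subset_right
    exact h1.add (h2.mul contDiffOn_const)
  · filter_upwards [hae₁, hae₂] with x h1 h2 hx
    rw [← Complex.re_add_im ((φ : ℝ → ℂ) x), h1 hx.1, h2 hx.2]

/-! ## §2c From the weak equation and smoothness to the classical equation -/

/-- If `φ =ᵐ g` with `g ∈ C^∞(V)`, `V` open, then `W g = μ g` holds pointwise on `V` (Green's formula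
against real test functions supported in small intervals, then the fundamental lemma of the calculus of
variations). [cite: ConnesMoscovici2022, §1 eq. (1.2) (= arXiv (2.2), chunk p0004:L16–L22)] -/
theorem prolateWaveOpFun_eq_of_weak (lam : ℝ) {φ : L2R} (hφ : φ ∈ (prolateMax lam).domain) {μ : ℝ}
    (hW : prolateMax lam ⟨φ, hφ⟩ = (μ : ℂ) • φ) {g : ℝ → ℂ} (hfg : (φ : ℝ → ℂ) =ᵐ[volume] g)
    {V : Set ℝ} (hV : IsOpen V) (hg : ContDiffOn ℝ ∞ g V) {x₀ : ℝ} (hx₀ : x₀ ∈ V) :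
    prolateWaveOpFun lam g x₀ = μ * g x₀ := by
  -- a closed interval around `x₀` inside `V`
  obtain ⟨r, hr, hball⟩ := Metric.isOpen_iff.mp hV x₀ hx₀
  set a : ℝ := x₀ - r / 2 with ha
  set b : ℝ := x₀ + r / 2 with hb
  have hab : a < b := by rw [ha, hb]; linarith
  have hIcc : Icc a b ⊆ V := by
    intro y hy
    apply hball
    rw [Metric.mem_ball, Real.dist_eq, abs_lt]
    constructor <;> [linarith [hy.1]; linarith [hy.2]]
  -- `star ∘ g` is smooth on `V` and `W (star g) − μ (star g)` is continuous there
  have hgs : ContDiffOn ℝ ∞ (fun y ↦ star (g y)) V :=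
    (Complex.conjCLE.contDiff).comp_contDiffOn hg
  have hgs2 : ContDiffOn ℝ 2 (fun y ↦ star (g y)) V := hgs.of_le (by norm_cast)
  set F : ℝ → ℂ := fun y ↦ prolateWaveOpFun lam (fun z ↦ star (g z)) y - μ * star (g y) with hF
  have hFc : ContinuousOn F V :=
    (continuousOn_prolateWaveOpFun lam hV hgs2).sub (continuousOn_const.mul hgs.continuousOn)
  -- the fundamental lemma on `Ioo a b`
  have hzero : ∀ᵐ x ∂volume, x ∈ Ioo a b → F x = 0 := by
    refine (isOpen_Ioo).ae_eq_zero_of_integral_contDiff_smul_eq_zero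
      ((hFc.mono (Ioo_subset_Icc_self.trans hIcc)).locallyIntegrableOn measurableSet_Ioo) ?_
    intro ρ hρs hρc hρsupp
    have hρ2 : ContDiff ℝ 2 ρ := hρs.of_le (by norm_cast)
    -- the weak identity, with `g` in place of `φ`
    have hweak := integral_conj_mul_prolateOp_sub_eq_zero lam hφ hW hρs hρc
    have hweak' : ∫ x, star (g x) * (((prolateOp lam ρ x - μ * ρ x : ℝ) : ℂ)) = 0 := by
      rw [← hweak]
      refine integral_congr_ae ?_
      filter_upwards [hfg] with x hx
      rw [hx]; rfl
    -- values of `ρ` and `ρ′` at the endpoints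
    have hnot : ∀ y, y ∉ Ioo a b → y ∉ tsupport ρ := fun y hy h ↦ hy (hρsupp h)
    have hρa : ρ a = 0 := image_eq_zero_of_notMem_tsupport (hnot a fun h ↦ lt_irrefl _ h.1)
    have hρb : ρ b = 0 := image_eq_zero_of_notMem_tsupport (hnot b fun h ↦ lt_irrefl _ h.2)
    have hdρ : ∀ y, y ∉ tsupport ρ → deriv ρ y = 0 := by
      intro y hy
      rw [(notMem_tsupport_iff_eventuallyEq.mp hy).deriv_eq]; simp
    have hρa' : deriv ρ a = 0 := hdρ a (hnot a fun h ↦ lt_irrefl _ h.1)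
    have hρb' : deriv ρ b = 0 := hdρ b (hnot b fun h ↦ lt_irrefl _ h.2)
    -- Green on `[a, b]` with `f = ρ` (complexified) and `star g`
    have hρC : ContDiffOn ℝ 2 (fun y ↦ (ρ y : ℂ)) V :=
      ((Complex.ofRealCLM.contDiff.comp hρ2)).contDiffOn
    have hgreen := intervalIntegral_green lam hV hρC hgs2 (a := a) (b := b)
      (by rw [uIcc_of_le hab.le]; exact hIcc)
    have hdρC : ∀ y, deriv (fun z ↦ (ρ z : ℂ)) y = ((deriv ρ y : ℝ) : ℂ) := fun y ↦
      (((hρ2.differentiable (by norm_num)) y).hasDerivAt.ofReal_comp).deriv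
    have hwa : wronskian lam (fun y ↦ (ρ y : ℂ)) (fun y ↦ star (g y)) a = 0 := by
      simp [wronskian, hdρC, hρa, hρa']
    have hwb : wronskian lam (fun y ↦ (ρ y : ℂ)) (fun y ↦ star (g y)) b = 0 := by
      simp [wronskian, hdρC, hρb, hρb']
    rw [hwa, hwb, sub_self] at hgreen
    -- `W ρ = L ρ` (real) and the integrand of `hweak'` vanishes off `Ioc a b`
    have hWρ : ∀ y, prolateWaveOpFun lam (fun z ↦ (ρ z : ℂ)) y = ((prolateOp lam ρ y : ℝ) : ℂ) :=
      prolateWaveOpFun_ofReal lam hρ2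
    have hvanish : ∀ y, y ∉ Ioc a b → star (g y) * (((prolateOp lam ρ y - μ * ρ y : ℝ) : ℂ)) = 0 := by
      intro y hy
      have hy' : y ∉ tsupport ρ := hnot y fun h ↦ hy ⟨h.1, h.2.le⟩
      rw [prolateOp_eq_zero_of_notMem_tsupport lam hy', image_eq_zero_of_notMem_tsupport hy']
      simp
    have hI : ∫ x, star (g x) * (((prolateOp lam ρ x - μ * ρ x : ℝ) : ℂ)) =
        ∫ x in a..b, star (g x) * (((prolateOp lam ρ x - μ * ρ x : ℝ) : ℂ)) := by
      rw [intervalIntegral.integral_of_le hab.le, ← setIntegral_eq_integral_of_forall_compl_eq_zero]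
      exact fun y hy ↦ hvanish y hy
    -- continuity on `[a, b]` of everything in sight
    have hc_sg : ContinuousOn (fun y ↦ star (g y)) (Icc a b) := hgs.continuousOn.mono hIcc
    have hc_Wsg : ContinuousOn (prolateWaveOpFun lam (fun z ↦ star (g z))) (Icc a b) :=
      (continuousOn_prolateWaveOpFun lam hV hgs2).mono hIcc
    have hc_ρ : ContinuousOn (fun y ↦ (ρ y : ℂ)) (Icc a b) :=
      (continuous_ofReal.comp hρ2.continuous).continuousOn
    have hc_Wρ : ContinuousOn (prolateWaveOpFun lam (fun z ↦ (ρ z : ℂ))) (Icc a b) :=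
      (continuousOn_prolateWaveOpFun lam hV hρC).mono hIcc
    have iA : IntervalIntegrable (fun x ↦ star (g x) * prolateWaveOpFun lam (fun z ↦ (ρ z : ℂ)) x)
        volume a b := (hc_sg.mul hc_Wρ).intervalIntegrable_of_Icc hab.le
    have iB : IntervalIntegrable (fun x ↦ (ρ x : ℂ) * prolateWaveOpFun lam (fun z ↦ star (g z)) x)
        volume a b := (hc_ρ.mul hc_Wsg).intervalIntegrable_of_Icc hab.le
    have iC : IntervalIntegrable (fun x ↦ (μ : ℂ) * ((ρ x : ℂ) * star (g x))) volume a b :=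
      (continuousOn_const.mul (hc_ρ.mul hc_sg)).intervalIntegrable_of_Icc hab.le
    -- S3: symmetry from Green
    have hS3 : ∫ x in a..b, (ρ x : ℂ) * prolateWaveOpFun lam (fun z ↦ star (g z)) x =
        ∫ x in a..b, star (g x) * prolateWaveOpFun lam (fun z ↦ (ρ z : ℂ)) x := by
      rw [intervalIntegral.integral_sub iA iB] at hgreen
      exact (sub_eq_zero.mp hgreen).symm
    -- S1: the test integral lives on `[a, b]`
    have hvanish' : ∀ y, y ∉ Ioc a b → (ρ y • F y) = 0 := by
      intro y hy
      have hy' : y ∉ tsupport ρ := hnot y fun h ↦ hy ⟨h.1, h.2.le⟩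
      rw [image_eq_zero_of_notMem_tsupport hy', zero_smul]
    have hS1 : ∫ x, ρ x • F x = ∫ x in a..b, (ρ x : ℂ) * F x := by
      rw [intervalIntegral.integral_of_le hab.le,
        ← setIntegral_eq_integral_of_forall_compl_eq_zero (fun y hy ↦ hvanish' y hy)]
      congr 1
    -- S2/S5: algebra of integrals
    have hS2 : ∫ x in a..b, (ρ x : ℂ) * F x =
        (∫ x in a..b, (ρ x : ℂ) * prolateWaveOpFun lam (fun z ↦ star (g z)) x) -
          ∫ x in a..b, (μ : ℂ) * ((ρ x : ℂ) * star (g x)) := by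
      rw [← intervalIntegral.integral_sub iB iC]
      congr 1; funext x; rw [hF]; ring
    have hS5 : (∫ x in a..b, star (g x) * prolateWaveOpFun lam (fun z ↦ (ρ z : ℂ)) x) -
          (∫ x in a..b, (μ : ℂ) * ((ρ x : ℂ) * star (g x))) =
        ∫ x in a..b, star (g x) * (((prolateOp lam ρ x - μ * ρ x : ℝ) : ℂ)) := by
      rw [← intervalIntegral.integral_sub iA iC]
      congr 1; funext x; rw [hWρ]; push_cast; ring
    rw [hS1, hS2, hS3, hS5, ← hI, hweak']
  -- conclude at `x₀`
  have hF0 : F x₀ = 0 := by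
    have hEq : EqOn F (fun _ ↦ (0 : ℂ)) (Ioo a b) :=
      Measure.eqOn_open_of_ae_eq ((ae_restrict_iff' measurableSet_Ioo).mpr hzero) isOpen_Ioo
        (hFc.mono (Ioo_subset_Icc_self.trans hIcc)) continuousOn_const
    exact hEq ⟨by rw [ha]; linarith, by rw [hb]; linarith⟩
  have hstar : prolateWaveOpFun lam (fun z ↦ star (g z)) x₀ = star (prolateWaveOpFun lam g x₀) :=
    prolateWaveOpFun_star lam g x₀
  have hF0' : prolateWaveOpFun lam (fun z ↦ star (g z)) x₀ - μ * star (g x₀) = 0 := hF0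
  rw [hstar] at hF0'
  have := congrArg star (sub_eq_zero.mp hF0')
  simpa using this

/-! ## §2d Regularity of the boundary-condition representative off `±λ` -/

/-- The open set `ℝ ∖ {±λ}` on which the boundary-condition representative is differentiable. [folklore] -/
private theorem isOpen_ne_ne (lam : ℝ) : IsOpen {x : ℝ | x ≠ lam ∧ x ≠ -lam} := isOpen_ne.and isOpen_ne

/-- Each point of `ℝ ∖ {±λ}` (`λ > 0`) lies in one of the three components `(−∞,−λ)`, `(−λ,λ)`, `(λ,∞)`,
on which `σ·(λ² − x²) > 0` for the sign `σ = −1, 1, −1` respectively. [folklore] -/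
private theorem exists_component_of_ne (lam : ℝ) (hlam : 0 < lam) {x₀ : ℝ} (h₁ : x₀ ≠ lam) (h₂ : x₀ ≠ -lam) :
    ∃ Ω : Set ℝ, IsOpen Ω ∧ x₀ ∈ Ω ∧ Ω ⊆ {x | x ≠ lam ∧ x ≠ -lam} ∧
      ∃ σ : ℝ, ∀ x ∈ Ω, 0 < σ * (lam ^ 2 - x ^ 2) := by
  rcases lt_or_gt_of_ne h₂ with hlt | hgt
  · refine ⟨Iio (-lam), isOpen_Iio, hlt, fun x (hx : x < -lam) ↦ ⟨by linarith, hx.ne⟩, -1,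
      fun x (hx : x < -lam) ↦ ?_⟩
    nlinarith
  rcases lt_or_gt_of_ne h₁ with hlt' | hgt'
  · refine ⟨Ioo (-lam) lam, isOpen_Ioo, ⟨hgt, hlt'⟩, fun x hx ↦ ⟨hx.2.ne, hx.1.ne'⟩, 1,
      fun x hx ↦ ?_⟩
    nlinarith [hx.1, hx.2]
  · refine ⟨Ioi lam, isOpen_Ioi, hgt', fun x (hx : lam < x) ↦ ⟨hx.ne', by linarith⟩, -1,
      fun x (hx : lam < x) ↦ ?_⟩
    nlinarith

/-- **Regularity of the boundary-condition representative**: if `φ ∈ dom W_max` with `W_max φ = μφ`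
(`μ` real) and `φ = g` a.e. with `g` differentiable on `ℝ ∖ {±λ}` (as in (1.19)–(1.21)), then `g` is
`C^∞` on `ℝ ∖ {±λ}` (interior elliptic regularity on each component, and continuity of `g` pins the
smooth representative down). [cite: ConnesMoscovici2022, §1 ¶1 and Lemma 1.1 proof (= arXiv §2 ¶1, chunk p0004:L16–L40)] -/
theorem contDiffOn_repr_of_mem_prolateMax (lam : ℝ) (hlam : 0 < lam) {φ : L2R}
    (hφ : φ ∈ (prolateMax lam).domain) {μ : ℝ} (hW : prolateMax lam ⟨φ, hφ⟩ = (μ : ℂ) • φ)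
    {g : ℝ → ℂ} (hfg : (φ : ℝ → ℂ) =ᵐ[volume] g)
    (hgd : DifferentiableOn ℝ g {x | x ≠ lam ∧ x ≠ -lam}) :
    ContDiffOn ℝ ∞ g {x | x ≠ lam ∧ x ≠ -lam} := by
  intro x₀ hx₀
  obtain ⟨Ω, hΩo, hx₀Ω, hΩS, σ, hpos⟩ := exists_component_of_ne lam hlam hx₀.1 hx₀.2
  obtain ⟨U, hUo, hx₀U, hUΩ, w, hw, hae⟩ := exists_smooth_repr_nhds lam hφ hW hΩo hpos hx₀Ω
  have hgw : EqOn g w U := by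
    have hae' : g =ᵐ[volume.restrict U] w := by
      rw [EventuallyEq, ae_restrict_iff' hUo.measurableSet]
      filter_upwards [hfg, hae] with x h1 h2 hxU
      rw [← h1]; exact h2 hxU
    exact Measure.eqOn_open_of_ae_eq hae' hUo (hgd.continuousOn.mono (hUΩ.trans hΩS))
      hw.continuousOn
  have hcd : ContDiffAt ℝ ∞ g x₀ :=
    (hw.contDiffAt (hUo.mem_nhds hx₀U)).congr_of_eventuallyEq
      (hgw.eventuallyEq_of_mem (hUo.mem_nhds hx₀U))
  exact hcd.contDiffWithinAt

/-- **The classical eigen-equation off `±λ`** for the boundary-condition representative: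
`W g = μ g` pointwise on `ℝ ∖ {±λ}`. [cite: ConnesMoscovici2022, §1 ¶1 (= arXiv §2 ¶1, chunk p0004:L16–L22)] -/
theorem prolateWaveOpFun_repr_eq (lam : ℝ) (hlam : 0 < lam) {φ : L2R}
    (hφ : φ ∈ (prolateMax lam).domain) {μ : ℝ} (hW : prolateMax lam ⟨φ, hφ⟩ = (μ : ℂ) • φ)
    {g : ℝ → ℂ} (hfg : (φ : ℝ → ℂ) =ᵐ[volume] g)
    (hgd : DifferentiableOn ℝ g {x | x ≠ lam ∧ x ≠ -lam}) {x : ℝ} (h₁ : x ≠ lam) (h₂ : x ≠ -lam) :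
    prolateWaveOpFun lam g x = μ * g x :=
  prolateWaveOpFun_eq_of_weak lam hφ hW hfg (isOpen_ne_ne lam)
    (contDiffOn_repr_of_mem_prolateMax lam hlam hφ hW hfg hgd) ⟨h₁, h₂⟩


/-! ## §4 The prolate functions `ψ_n` on `(−1, 1)` -/

/-- On an open set where a real `ρ` is `C²`, the complex prolate wave operator applied to `ρ` is the
real one, cast. [folklore] -/
private theorem prolateWaveOpFun_ofReal_of_contDiffOn (lam : ℝ) {ρ : ℝ → ℝ} {U : Set ℝ} (hU : IsOpen U)
    (hρ : ContDiffOn ℝ 2 ρ U) {x : ℝ} (hx : x ∈ U) :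
    prolateWaveOpFun lam (fun y ↦ (ρ y : ℂ)) x = ((prolateOp lam ρ x : ℝ) : ℂ) := by
  have hρ1 : ∀ y ∈ U, DifferentiableAt ℝ ρ y := fun y hy ↦
    (hρ.differentiableOn (by norm_num) y hy).differentiableAt (hU.mem_nhds hy)
  have hdρ : ContDiffOn ℝ 1 (deriv ρ) U := hρ.deriv_of_isOpen hU (by norm_num)
  have hd1 : ∀ y ∈ U, deriv (fun y ↦ (ρ y : ℂ)) y = ((deriv ρ y : ℝ) : ℂ) := fun y hy ↦
    ((hρ1 y hy).hasDerivAt.ofReal_comp).deriv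
  have hin : (fun y ↦ ((lam ^ 2 - y ^ 2 : ℝ) : ℂ) * deriv (fun y ↦ (ρ y : ℂ)) y) =ᶠ[𝓝 x]
      fun y ↦ (((lam ^ 2 - y ^ 2) * deriv ρ y : ℝ) : ℂ) := by
    filter_upwards [hU.mem_nhds hx] with y hy
    rw [hd1 y hy]; push_cast; ring
  have hdin : DifferentiableAt ℝ (fun y ↦ (lam ^ 2 - y ^ 2) * deriv ρ y) x :=
    ((differentiableAt_const _).sub (differentiableAt_pow 2)).mul
      ((hdρ.differentiableOn one_ne_zero x hx).differentiableAt (hU.mem_nhds hx))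
  have hd2 : deriv (fun y ↦ (((lam ^ 2 - y ^ 2) * deriv ρ y : ℝ) : ℂ)) x =
      ((deriv (fun y ↦ (lam ^ 2 - y ^ 2) * deriv ρ y) x : ℝ) : ℂ) :=
    (hdin.hasDerivAt.ofReal_comp).deriv
  rw [prolateWaveOpFun, hin.deriv_eq, hd2, prolateOp]
  push_cast; ring

/-- `ψ_n` (complexified) is `C²` on `(−1, 1)`. [cite: ConnesConsani2021, §4 p. 16 (arXiv p0016:L17–L28)] -/
theorem contDiffOn_prolateXiFun_Ioo (n : ℕ) : ContDiffOn ℝ 2 (prolateXiFun n) (Ioo (-1 : ℝ) 1) :=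
  Complex.ofRealCLM.contDiff.comp_contDiffOn
    ((isProlateFunction_prolateFun n).contDiffOn.mono Ioo_subset_Icc_self)

/-- The derivative of `ψ_n` (complexified) on `(−1, 1)` is the real derivative, cast; on `(−1, 1)` the
latter is the derivative within `[−1, 1]`. [folklore] -/
private theorem deriv_prolateXiFun_eq (n : ℕ) {x : ℝ} (hx : x ∈ Ioo (-1 : ℝ) 1) :
    deriv (prolateXiFun n) x = ((derivWithin (prolateFun n) (Icc (-1 : ℝ) 1) x : ℝ) : ℂ) := by
  have hd : DifferentiableAt ℝ (prolateFun n) x :=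
    ((isProlateFunction_prolateFun n).contDiffOn.differentiableOn (by norm_num) x
      (Ioo_subset_Icc_self hx)).differentiableAt (Icc_mem_nhds hx.1 hx.2)
  rw [show prolateXiFun n = fun y ↦ ((prolateFun n y : ℝ) : ℂ) from rfl,
    (hd.hasDerivAt.ofReal_comp).deriv, derivWithin_of_mem_nhds (Icc_mem_nhds hx.1 hx.2)]

/-- **The eigen-equation of `ψ_n`** in complex form: `W ψ_n = χ_n ψ_n` on `(−1, 1)` with `χ_n > 0`
(`χ_n > 2n(2n+1) ≥ 0`, tree theorem `IsProlateFunction.lt_eigen`). [cite: ConnesConsani2021, §4 p. 16 eq. (prolateeq) (arXiv p0016:L17–L28)] -/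
theorem exists_eigen_prolateXiFun (n : ℕ) : ∃ χ : ℝ, 0 < χ ∧ ∀ x ∈ Ioo (-1 : ℝ) 1,
    prolateWaveOpFun 1 (prolateXiFun n) x = (χ : ℂ) * prolateXiFun n x := by
  obtain ⟨χ, hχ⟩ := (isProlateFunction_prolateFun n).eigen
  have hlt := (isProlateFunction_prolateFun n).lt_eigen hχ
  refine ⟨χ, lt_of_le_of_lt (by positivity) hlt, fun x hx ↦ ?_⟩
  have h1 : -(1 : ℝ) = -1 := rfl
  rw [show prolateXiFun n = fun y ↦ ((prolateFun n y : ℝ) : ℂ) from rfl,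
    prolateWaveOpFun_ofReal_of_contDiffOn 1 isOpen_Ioo
      ((isProlateFunction_prolateFun n).contDiffOn.mono Ioo_subset_Icc_self) hx, prolateOp, hχ x hx]
  push_cast; ring

/-- `ψ_n(x) → ψ_n(1)` as `x → 1⁻` (continuity on `[−1, 1]`). [folklore] -/
private theorem tendsto_prolateXiFun_left (n : ℕ) :
    Tendsto (prolateXiFun n) (𝓝[<] (1 : ℝ)) (𝓝 (prolateXiFun n 1)) := by
  have h := (continuousOn_prolateXiFun n) 1 (right_mem_Icc.mpr (by norm_num))
  exact h.tendsto.mono_left (nhdsWithin_le_iff.mpr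
    (mem_of_superset (Ioo_mem_nhdsLT (by norm_num : (-1 : ℝ) < 1)) Ioo_subset_Icc_self))

/-- `ψ_n(x) → ψ_n(−1)` as `x → (−1)⁺`. [folklore] -/
private theorem tendsto_prolateXiFun_right (n : ℕ) :
    Tendsto (prolateXiFun n) (𝓝[>] (-1 : ℝ)) (𝓝 (prolateXiFun n (-1))) := by
  have h := (continuousOn_prolateXiFun n) (-1) (left_mem_Icc.mpr (by norm_num))
  exact h.tendsto.mono_left (nhdsWithin_le_iff.mpr
    (mem_of_superset (Ioo_mem_nhdsGT (by norm_num : (-1 : ℝ) < 1)) Ioo_subset_Icc_self))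

/-- `ψ_n′` has a limit at `1⁻` (it is continuous on `[−1, 1]`). [folklore] -/
private theorem tendsto_deriv_prolateXiFun_left (n : ℕ) :
    Tendsto (deriv (prolateXiFun n)) (𝓝[<] (1 : ℝ))
      (𝓝 ((derivWithin (prolateFun n) (Icc (-1 : ℝ) 1) 1 : ℝ) : ℂ)) := by
  have hc : ContinuousOn (derivWithin (prolateFun n) (Icc (-1 : ℝ) 1)) (Icc (-1 : ℝ) 1) :=
    (isProlateFunction_prolateFun n).contDiffOn.continuousOn_derivWithin
      (uniqueDiffOn_Icc (by norm_num)) (by norm_num)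
  have h := ((Complex.continuous_ofReal.continuousAt).comp_continuousWithinAt
    (hc 1 (right_mem_Icc.mpr (by norm_num)))).tendsto
  have h' := h.mono_left (nhdsWithin_le_iff.mpr
    (mem_of_superset (Ioo_mem_nhdsLT (by norm_num : (-1 : ℝ) < 1)) Ioo_subset_Icc_self))
  refine h'.congr' ?_
  filter_upwards [Ioo_mem_nhdsLT (by norm_num : (-1 : ℝ) < 1)] with x hx
  exact (deriv_prolateXiFun_eq n hx).symm

/-- `ψ_n′` has a limit at `(−1)⁺`. [folklore] -/
private theorem tendsto_deriv_prolateXiFun_right (n : ℕ) :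
    Tendsto (deriv (prolateXiFun n)) (𝓝[>] (-1 : ℝ))
      (𝓝 ((derivWithin (prolateFun n) (Icc (-1 : ℝ) 1) (-1) : ℝ) : ℂ)) := by
  have hc : ContinuousOn (derivWithin (prolateFun n) (Icc (-1 : ℝ) 1)) (Icc (-1 : ℝ) 1) :=
    (isProlateFunction_prolateFun n).contDiffOn.continuousOn_derivWithin
      (uniqueDiffOn_Icc (by norm_num)) (by norm_num)
  have h := ((Complex.continuous_ofReal.continuousAt).comp_continuousWithinAt
    (hc (-1) (left_mem_Icc.mpr (by norm_num)))).tendsto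
  have h' := h.mono_left (nhdsWithin_le_iff.mpr
    (mem_of_superset (Ioo_mem_nhdsGT (by norm_num : (-1 : ℝ) < 1)) Ioo_subset_Icc_self))
  refine h'.congr' ?_
  filter_upwards [Ioo_mem_nhdsGT (by norm_num : (-1 : ℝ) < 1)] with x hx
  exact (deriv_prolateXiFun_eq n hx).symm


/-! ## §5 The `P`-half: `⟪ξ_n, φ⟫ = 0` for every `n`, hence `P_1 φ = 0` -/

/-- **Vanishing of the boundary Wronskian** (filter-generic): if along `l` one has `p g′ → 0`,
`p g → 0`, and `f`, `f′` have limits, then `[f, g] = f·(p g′) − f′·(p g) → 0`. [folklore] -/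
private theorem tendsto_wronskian_zero {lam : ℝ} {l : Filter ℝ} {f g : ℝ → ℂ} {c₁ c₂ : ℂ}
    (hf : Tendsto f l (𝓝 c₁)) (hf' : Tendsto (deriv f) l (𝓝 c₂))
    (hg' : Tendsto (fun x ↦ pCoeff lam x * deriv g x) l (𝓝 0))
    (hg : Tendsto (fun x ↦ pCoeff lam x * g x) l (𝓝 0)) :
    Tendsto (wronskian lam f g) l (𝓝 0) := by
  have h := (hf.mul hg').sub (hf'.mul hg)
  rw [mul_zero, mul_zero, sub_zero] at h
  refine h.congr' (Eventually.of_forall fun x ↦ ?_)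
  simp only [wronskian]; ring

/-- At `1⁻`: the boundary condition `p g′ → 0` (1.19) gives `(1 − x) g′ → 0`. [folklore] -/
private theorem tendsto_one_sub_mul_deriv {g : ℝ → ℂ}
    (h : Tendsto (fun x ↦ pCoeff 1 x * deriv g x) (𝓝[<] (1 : ℝ)) (𝓝 0)) :
    Tendsto (fun x ↦ ((1 - x : ℝ) : ℂ) * deriv g x) (𝓝[<] (1 : ℝ)) (𝓝 0) := by
  have hc : Tendsto (fun x : ℝ ↦ (((1 + x)⁻¹ : ℝ) : ℂ)) (𝓝[<] (1 : ℝ)) (𝓝 (((1 + 1)⁻¹ : ℝ) : ℂ)) := by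
    refine (Complex.continuous_ofReal.tendsto _).comp ?_
    exact ((tendsto_const_nhds.add tendsto_id).inv₀ (by norm_num)).mono_left nhdsWithin_le_nhds
  have h2 := h.mul hc
  rw [zero_mul] at h2
  refine h2.congr' ?_
  filter_upwards [Ioo_mem_nhdsLT (by norm_num : (-1 : ℝ) < 1)] with x hx
  have hx' : (1 + x : ℂ) ≠ 0 := by
    rw [← Complex.ofReal_one, ← Complex.ofReal_add, Complex.ofReal_ne_zero]; linarith [hx.1]
  simp only [pCoeff]
  rw [show ((1 : ℝ) ^ 2 - x ^ 2 : ℝ) = (1 - x) * (1 + x) by ring]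
  push_cast
  field_simp

/-- At `(−1)⁺`: the boundary condition `p g′ → 0` gives `(x + 1) g′ → 0`. [folklore] -/
private theorem tendsto_add_one_mul_deriv {g : ℝ → ℂ}
    (h : Tendsto (fun x ↦ pCoeff 1 x * deriv g x) (𝓝[>] (-1 : ℝ)) (𝓝 0)) :
    Tendsto (fun x ↦ ((x - (-1) : ℝ) : ℂ) * deriv g x) (𝓝[>] (-1 : ℝ)) (𝓝 0) := by
  have hc : Tendsto (fun x : ℝ ↦ (((1 - x)⁻¹ : ℝ) : ℂ)) (𝓝[>] (-1 : ℝ))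
      (𝓝 (((1 - (-1))⁻¹ : ℝ) : ℂ)) := by
    refine (Complex.continuous_ofReal.tendsto _).comp ?_
    exact ((tendsto_const_nhds.sub tendsto_id).inv₀ (by norm_num)).mono_left nhdsWithin_le_nhds
  have h2 := h.mul hc
  rw [zero_mul] at h2
  refine h2.congr' ?_
  filter_upwards [Ioo_mem_nhdsGT (by norm_num : (-1 : ℝ) < 1)] with x hx
  have hx' : (1 - x : ℂ) ≠ 0 := by
    rw [← Complex.ofReal_one, ← Complex.ofReal_sub, Complex.ofReal_ne_zero]; linarith [hx.2]
  simp only [pCoeff]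
  rw [show ((1 : ℝ) ^ 2 - x ^ 2 : ℝ) = (x - (-1)) * (1 - x) by ring]
  push_cast
  field_simp

/-- At `1⁻`: `p g′ → 0` forces `p g → 0` (via §1). [folklore] -/
private theorem tendsto_pCoeff_mul_left {g : ℝ → ℂ} (hg : DifferentiableOn ℝ g (Ioo (-1 : ℝ) 1))
    (h : Tendsto (fun x ↦ pCoeff 1 x * deriv g x) (𝓝[<] (1 : ℝ)) (𝓝 0)) :
    Tendsto (fun x ↦ pCoeff 1 x * g x) (𝓝[<] (1 : ℝ)) (𝓝 0) := by
  have h1 := tendsto_sub_mul_of_deriv_left (by norm_num : (-1 : ℝ) < 1) hg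
    (tendsto_one_sub_mul_deriv h)
  have hc : Tendsto (fun x : ℝ ↦ ((1 + x : ℝ) : ℂ)) (𝓝[<] (1 : ℝ)) (𝓝 ((1 + 1 : ℝ) : ℂ)) :=
    ((Complex.continuous_ofReal.tendsto _).comp
      (tendsto_const_nhds.add tendsto_id)).mono_left nhdsWithin_le_nhds
  have h2 := hc.mul h1
  rw [mul_zero] at h2
  refine h2.congr' (Eventually.of_forall fun x ↦ ?_)
  simp only [pCoeff]; push_cast; ring

/-- At `(−1)⁺`: `p g′ → 0` forces `p g → 0` (via §1). [folklore] -/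
private theorem tendsto_pCoeff_mul_right {g : ℝ → ℂ} (hg : DifferentiableOn ℝ g (Ioo (-1 : ℝ) 1))
    (h : Tendsto (fun x ↦ pCoeff 1 x * deriv g x) (𝓝[>] (-1 : ℝ)) (𝓝 0)) :
    Tendsto (fun x ↦ pCoeff 1 x * g x) (𝓝[>] (-1 : ℝ)) (𝓝 0) := by
  have h1 := tendsto_sub_mul_of_deriv_right (by norm_num : (-1 : ℝ) < 1) hg
    (tendsto_add_one_mul_deriv h)
  have hc : Tendsto (fun x : ℝ ↦ ((1 - x : ℝ) : ℂ)) (𝓝[>] (-1 : ℝ)) (𝓝 ((1 - (-1) : ℝ) : ℂ)) :=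
    ((Complex.continuous_ofReal.tendsto _).comp
      (tendsto_const_nhds.sub tendsto_id)).mono_left nhdsWithin_le_nhds
  have h2 := hc.mul h1
  rw [mul_zero] at h2
  refine h2.congr' (Eventually.of_forall fun x ↦ ?_)
  simp only [pCoeff]; push_cast; ring

/-- **`∫_{−1}^{1} ψ_n g = 0`**: Green's formula on `[a, b] ⊂ (−1, 1)` for the pair `(ψ_n, g)` reads
`(χ_n − μ) ∫_a^b ψ_n g = [ψ_n, g](b) − [ψ_n, g](a)`; the boundary Wronskians vanish in the limit
`a → −1⁺`, `b → 1⁻` by the boundary condition (1.19) on `g` (and `ψ_n ∈ C²[−1, 1]`), and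
`χ_n > 0 > μ`. [cite: ConnesMoscovici2022, Cor 2.2 (= arXiv Cor 3.2, chunk p0008:L79–L84); §1 eqs. (1.5)–(1.6) (= arXiv (2.5)–(2.6), chunk p0005:L31–L40)] -/
theorem intervalIntegral_prolateXiFun_mul_eq_zero {φ : L2R} (hφ : φ ∈ (prolateMax 1).domain)
    {μ : ℝ} (hμ : μ < 0) (hW : prolateMax 1 ⟨φ, hφ⟩ = (μ : ℂ) • φ) {g : ℝ → ℂ}
    (hfg : (φ : ℝ → ℂ) =ᵐ[volume] g) (hbc : ProlateBC 1 g) (n : ℕ) :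
    ∫ x in (-1 : ℝ)..1, prolateXiFun n x * g x = 0 := by
  set S : Set ℝ := {x | x ≠ 1 ∧ x ≠ -1} with hS
  set U : Set ℝ := Ioo (-1 : ℝ) 1 with hU
  have hUS : U ⊆ S := fun x hx ↦ ⟨hx.2.ne, hx.1.ne'⟩
  have hgS : ContDiffOn ℝ ∞ g S :=
    contDiffOn_repr_of_mem_prolateMax 1 one_pos hφ hW hfg hbc.differentiableOn
  have hg2 : ContDiffOn ℝ 2 g U := (hgS.mono hUS).of_le (by norm_cast)
  have hf2 : ContDiffOn ℝ 2 (prolateXiFun n) U := contDiffOn_prolateXiFun_Ioo n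
  have hode : ∀ x ∈ U, prolateWaveOpFun 1 g x = μ * g x := fun x hx ↦
    prolateWaveOpFun_repr_eq 1 one_pos hφ hW hfg hbc.differentiableOn (hUS hx).1 (hUS hx).2
  obtain ⟨χ, hχpos, hχ⟩ := exists_eigen_prolateXiFun n
  have hχμ : ((χ : ℂ) - μ) ≠ 0 := by
    rw [← Complex.ofReal_sub]; exact_mod_cast (by linarith : χ - μ ≠ 0)
  -- integrability of `ψ_n g` on `[−1, 1]`
  have hInt : IntegrableOn (fun x ↦ prolateXiFun n x * g x) (Icc (-1 : ℝ) 1) := by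
    haveI : IsFiniteMeasure ((volume : Measure ℝ).restrict (Icc (-1 : ℝ) 1)) :=
      isFiniteMeasure_restrict.2 measure_Icc_lt_top.ne
    have hφi : IntegrableOn (φ : ℝ → ℂ) (Icc (-1 : ℝ) 1) :=
      ((Lp.memLp φ).restrict (Icc (-1 : ℝ) 1)).integrable (by norm_num)
    have hgi : IntegrableOn g (Icc (-1 : ℝ) 1) := hφi.congr_fun_ae (ae_restrict_of_ae hfg)
    exact hgi.continuousOn_mul (continuousOn_prolateXiFun n) isCompact_Icc
  have hii : ∀ {a b : ℝ}, a ∈ Icc (-1 : ℝ) 1 → b ∈ Icc (-1 : ℝ) 1 →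
      IntervalIntegrable (fun x ↦ prolateXiFun n x * g x) volume a b := fun ha hb ↦
    (hInt.mono_set (uIcc_subset_Icc ha hb)).intervalIntegrable
  -- the primitive `Φ(t) = ∫_0^t ψ_n g` and its continuity on `[−1, 1]`
  set Φ : ℝ → ℂ := fun t ↦ ∫ x in (0 : ℝ)..t, prolateXiFun n x * g x with hΦ
  have h0 : (0 : ℝ) ∈ Icc (-1 : ℝ) 1 := by constructor <;> norm_num
  have hΦc : ContinuousOn Φ (Icc (-1 : ℝ) 1) := by
    have := intervalIntegral.continuousOn_primitive_interval' (μ := volume)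
      (hii (a := -1) (b := 1) (left_mem_Icc.mpr (by norm_num)) (right_mem_Icc.mpr (by norm_num)))
      (a := 0) (by rw [uIcc_of_le (by norm_num)]; exact h0)
    rwa [uIcc_of_le (by norm_num)] at this
  -- Green on `[a, b] ⊂ (−1, 1)`: `(χ − μ)(Φ b − Φ a) = [ψ_n, g](b) − [ψ_n, g](a)`
  have hgreen : ∀ a ∈ U, ∀ b ∈ U, ((χ : ℂ) - μ) * (Φ b - Φ a) =
      wronskian 1 (prolateXiFun n) g b - wronskian 1 (prolateXiFun n) g a := by
    intro a ha b hb
    have hsub : uIcc a b ⊆ U := by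
      rcases le_total a b with hab | hab
      · rw [uIcc_of_le hab]; exact fun x hx ↦ ⟨ha.1.trans_le hx.1, hx.2.trans_lt hb.2⟩
      · rw [uIcc_of_ge hab]; exact fun x hx ↦ ⟨hb.1.trans_le hx.1, hx.2.trans_lt ha.2⟩
    have hG := intervalIntegral_green 1 isOpen_Ioo hf2 hg2 hsub
    have hcongr : ∫ x in a..b, (g x * prolateWaveOpFun 1 (prolateXiFun n) x -
        prolateXiFun n x * prolateWaveOpFun 1 g x) =
        ∫ x in a..b, ((χ : ℂ) - μ) * (prolateXiFun n x * g x) := by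
      refine intervalIntegral.integral_congr fun x hx ↦ ?_
      show g x * prolateWaveOpFun 1 (prolateXiFun n) x - prolateXiFun n x * prolateWaveOpFun 1 g x =
        ((χ : ℂ) - μ) * (prolateXiFun n x * g x)
      rw [hχ x (hsub hx), hode x (hsub hx)]; ring
    rw [hcongr, intervalIntegral.integral_const_mul] at hG
    have hΦab : Φ b - Φ a = ∫ x in a..b, prolateXiFun n x * g x := by
      simp only [hΦ]
      exact intervalIntegral.integral_interval_sub_left
        (hii h0 (Ioo_subset_Icc_self hb)) (hii h0 (Ioo_subset_Icc_self ha))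
    rw [hΦab, hG]
  -- the boundary Wronskians vanish in the limit
  have hSl : S ∈ 𝓝[<] (1 : ℝ) :=
    mem_of_superset (Ioo_mem_nhdsLT (by norm_num : (-1 : ℝ) < 1)) hUS
  have hSr : S ∈ 𝓝[>] (-1 : ℝ) :=
    mem_of_superset (Ioo_mem_nhdsGT (by norm_num : (-1 : ℝ) < 1)) hUS
  have hbl : Tendsto (fun x ↦ pCoeff 1 x * deriv g x) (𝓝[<] (1 : ℝ)) (𝓝 0) :=
    hbc.atLam.mono_left (nhdsWithin_le_iff.mpr hSl)
  have hbr : Tendsto (fun x ↦ pCoeff 1 x * deriv g x) (𝓝[>] (-1 : ℝ)) (𝓝 0) := by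
    have := hbc.atNegLam; exact this.mono_left (nhdsWithin_le_iff.mpr hSr)
  have hgU : DifferentiableOn ℝ g U := hbc.differentiableOn.mono hUS
  have hwl : Tendsto (wronskian 1 (prolateXiFun n) g) (𝓝[<] (1 : ℝ)) (𝓝 0) :=
    tendsto_wronskian_zero (tendsto_prolateXiFun_left n) (tendsto_deriv_prolateXiFun_left n) hbl
      (tendsto_pCoeff_mul_left hgU hbl)
  have hwr : Tendsto (wronskian 1 (prolateXiFun n) g) (𝓝[>] (-1 : ℝ)) (𝓝 0) :=
    tendsto_wronskian_zero (tendsto_prolateXiFun_right n) (tendsto_deriv_prolateXiFun_right n) hbr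
      (tendsto_pCoeff_mul_right hgU hbr)
  -- `Φ` has limits `Φ(±1)` at the endpoints
  have hΦl : Tendsto Φ (𝓝[<] (1 : ℝ)) (𝓝 (Φ 1)) :=
    (hΦc 1 (right_mem_Icc.mpr (by norm_num))).tendsto.mono_left (nhdsWithin_le_iff.mpr
      (mem_of_superset (Ioo_mem_nhdsLT (by norm_num : (-1 : ℝ) < 1)) Ioo_subset_Icc_self))
  have hΦr : Tendsto Φ (𝓝[>] (-1 : ℝ)) (𝓝 (Φ (-1))) :=
    (hΦc (-1) (left_mem_Icc.mpr (by norm_num))).tendsto.mono_left (nhdsWithin_le_iff.mpr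
      (mem_of_superset (Ioo_mem_nhdsGT (by norm_num : (-1 : ℝ) < 1)) Ioo_subset_Icc_self))
  -- `F(t) = (χ − μ) Φ(t) − [ψ_n, g](t)` is constant on `(−1, 1)`; compare its two boundary limits
  set F : ℝ → ℂ := fun t ↦ ((χ : ℂ) - μ) * Φ t - wronskian 1 (prolateXiFun n) g t with hF
  have hFconst : ∀ a ∈ U, ∀ b ∈ U, F b = F a := by
    intro a ha b hb
    have := hgreen a ha b hb
    simp only [hF]
    linear_combination this
  have hFl : Tendsto F (𝓝[<] (1 : ℝ)) (𝓝 (((χ : ℂ) - μ) * Φ 1)) := by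
    have := (hΦl.const_mul ((χ : ℂ) - μ)).sub hwl
    rwa [sub_zero] at this
  have hFr : Tendsto F (𝓝[>] (-1 : ℝ)) (𝓝 (((χ : ℂ) - μ) * Φ (-1))) := by
    have := (hΦr.const_mul ((χ : ℂ) - μ)).sub hwr
    rwa [sub_zero] at this
  have h0U : (0 : ℝ) ∈ U := ⟨by norm_num, by norm_num⟩
  have hF0l : Tendsto F (𝓝[<] (1 : ℝ)) (𝓝 (F 0)) := by
    refine tendsto_const_nhds.congr' ?_
    filter_upwards [Ioo_mem_nhdsLT (by norm_num : (-1 : ℝ) < 1)] with x hx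
    exact (hFconst 0 h0U x hx).symm
  have hF0r : Tendsto F (𝓝[>] (-1 : ℝ)) (𝓝 (F 0)) := by
    refine tendsto_const_nhds.congr' ?_
    filter_upwards [Ioo_mem_nhdsGT (by norm_num : (-1 : ℝ) < 1)] with x hx
    exact (hFconst 0 h0U x hx).symm
  have e1 : ((χ : ℂ) - μ) * Φ 1 = F 0 := tendsto_nhds_unique hFl hF0l
  have e2 : ((χ : ℂ) - μ) * Φ (-1) = F 0 := tendsto_nhds_unique hFr hF0r
  have hΦ1 : Φ 1 - Φ (-1) = 0 := by
    have : ((χ : ℂ) - μ) * (Φ 1 - Φ (-1)) = 0 := by rw [mul_sub, e1, e2, sub_self]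
    exact (mul_eq_zero.mp this).resolve_left hχμ
  have hsplit : ∫ x in (-1 : ℝ)..1, prolateXiFun n x * g x = Φ 1 - Φ (-1) := by
    simp only [hΦ]
    exact (intervalIntegral.integral_interval_sub_left
      (hii h0 (right_mem_Icc.mpr (by norm_num))) (hii h0 (left_mem_Icc.mpr (by norm_num)))).symm
  rw [hsplit, hΦ1]

/-- `⟪ξ_n, φ⟫ = ∫_{−1}^{1} ψ_n g` for any a.e. representative `g` of `φ` (`ψ_n` is real and vanishes
off `[−1, 1]`). [cite: ConnesConsani2021, Prop. 4.5 (i) §4 p. 16 (arXiv p0016:L50)] -/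
theorem inner_prolateXi_eq_intervalIntegral {φ : L2R} {g : ℝ → ℂ}
    (hfg : (φ : ℝ → ℂ) =ᵐ[volume] g) (n : ℕ) :
    ⟪prolateXi n, φ⟫_ℂ = ∫ x in (-1 : ℝ)..1, prolateXiFun n x * g x := by
  rw [L2.inner_def]
  have h1 : ∫ a : ℝ, ⟪(prolateXi n : ℝ → ℂ) a, (φ : ℝ → ℂ) a⟫_ℂ =
      ∫ a : ℝ, prolateXiFun n a * g a := by
    refine integral_congr_ae ?_
    filter_upwards [prolateXi_coeFn n, hfg] with a ha hb
    rw [ha, hb, RCLike.inner_apply]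
    simp [prolateXiFun, mul_comm]
  have h2 : ∫ a : ℝ, prolateXiFun n a * g a = ∫ a in Icc (-1 : ℝ) 1, prolateXiFun n a * g a := by
    refine (setIntegral_eq_integral_of_forall_compl_eq_zero fun x hx ↦ ?_).symm
    have h := congrFun (prolateXiFun_eq_indicator n) x
    rw [indicator_of_notMem hx] at h
    rw [h, zero_mul]
  rw [h1, h2, integral_Icc_eq_integral_Ioc, ← intervalIntegral.integral_of_le (by norm_num)]

/-- **`⟪ξ_n, φ⟫ = 0` for every `n`**, for `φ ∈ dom W_max` with `W_max φ = μφ`, `μ < 0`, satisfying the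
boundary condition (1.19) at `±1` through a representative `g`. [cite: ConnesMoscovici2022, Cor 2.2 (= arXiv Cor 3.2, chunk p0008:L79–L84)] -/
theorem inner_prolateXi_eq_zero {φ : L2R} (hφ : φ ∈ (prolateMax 1).domain) {μ : ℝ} (hμ : μ < 0)
    (hW : prolateMax 1 ⟨φ, hφ⟩ = (μ : ℂ) • φ) {g : ℝ → ℂ} (hfg : (φ : ℝ → ℂ) =ᵐ[volume] g)
    (hbc : ProlateBC 1 g) (n : ℕ) : ⟪prolateXi n, φ⟫_ℂ = 0 := by
  rw [inner_prolateXi_eq_intervalIntegral hfg,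
    intervalIntegral_prolateXiFun_mul_eq_zero hφ hμ hW hfg hbc]

/-- From `W_sa` data to `W_max` data: an eigenvector of `W_sa` is an eigenvector of `W_max` with a
boundary-condition representative. [cite: ConnesMoscovici2022, §1 Definition before Thm 1.6 (= arXiv chunk p0006:L52–L69)] -/
theorem exists_repr_of_hasEigenvector {lam : ℝ} {W : L2R →ₗ.[ℂ] L2R} (hSA : IsProlateSA lam W)
    {μ : ℂ} {φ : L2R} (hev : W.HasEigenvector μ φ) :
    ∃ hφ : φ ∈ (prolateMax lam).domain, prolateMax lam ⟨φ, hφ⟩ = μ • φ ∧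
      ∃ g : ℝ → ℂ, (φ : ℝ → ℂ) =ᵐ[volume] g ∧ ProlateBC lam g := by
  obtain ⟨hle, hdom⟩ := hSA
  obtain ⟨hxW, hWφ⟩ := LinearPMap.mem_eigenspace_iff.mp hev.1
  obtain ⟨hdomle, hagree⟩ := hle
  have hφ : φ ∈ (prolateMax lam).domain := hdomle hxW
  have hSAS : φ ∈ prolateSASet lam := by rw [← hdom]; exact hxW
  obtain ⟨_, g, hfg, hbc⟩ := hSAS
  exact ⟨hφ, ((hagree (x := ⟨φ, hxW⟩) (y := ⟨φ, hφ⟩) rfl).symm.trans hWφ), g, hfg, hbc⟩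

/-- **Cor 2.2, `P`-half: `P_1 φ = 0`** — an even eigenfunction of `W_sa` (`λ = 1`) with negative
eigenvalue vanishes on `[−1, 1]`: it is orthogonal to every `ξ_n` (`inner_prolateXi_eq_zero`), and the
`ξ_n` are complete in the even part of the range of `P_1` (tree theorem `CC2021_sec4_xi_complete_holds`).
RH-FREE. [cite: ConnesMoscovici2022, Cor 2.2 (= arXiv:2112.05500 Cor 3.2, chunk p0008:L79–L84)] -/
theorem cutoffProj_eq_zero_of_hasEigenvector {W : L2R →ₗ.[ℂ] L2R} (hSA : IsProlateSA 1 W)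
    {μ : ℝ} (hμ : μ < 0) {φ : L2R} (hev : W.HasEigenvector (μ : ℂ) φ)
    (heven : ∀ᵐ x : ℝ, (φ : ℝ → ℂ) (-x) = (φ : ℝ → ℂ) x) : cutoffProj 1 φ = 0 := by
  obtain ⟨hφ, hW, g, hfg, hbc⟩ := exists_repr_of_hasEigenvector hSA hev
  have hperp : ∀ n, ⟪prolateXi n, φ⟫_ℂ = 0 := fun n ↦ inner_prolateXi_eq_zero hφ hμ hW hfg hbc n
  have hevφ : φ ∈ evenPart := mem_evenPart_iff.mpr heven
  refine CC2021_sec4_xi_complete_holds (cutoffProj 1 φ) (cutoffProj_mem_evenPart 1 hevφ) ?_ ?_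
  · show cutoffProj 1 (cutoffProj 1 φ) = cutoffProj 1 φ
    exact congrFun (congrArg DFunLike.coe (cutoffProj_idem 1).eq) φ
  · intro n
    have hsym := ContinuousLinearMap.isSelfAdjoint_iff_isSymmetric.mp (cutoffProj_isSelfAdjoint 1)
    have h := hsym (prolateXi n) φ
    simp only [ContinuousLinearMap.coe_coe] at h
    rw [← h, cutoffProj_prolateXi]
    exact hperp n

/-- **Cor 2.2, `P`-half, in the binder shape of `CM22_cor_2_2`.** RH-FREE.
[cite: ConnesMoscovici2022, Cor 2.2 (= arXiv:2112.05500 Cor 3.2, chunk p0008:L79–L84)] -/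
theorem CM22_cor_2_2_cutoffProj :
    ∀ W : L2R →ₗ.[ℂ] L2R, IsProlateSA 1 W →
      ∀ (μ : ℝ), μ < 0 → ∀ φ : L2R, W.HasEigenvector (μ : ℂ) φ →
        (∀ᵐ x : ℝ, (φ : ℝ → ℂ) (-x) = (φ : ℝ → ℂ) x) → cutoffProj 1 φ = 0 :=
  fun _ hSA _ hμ _ hev heven ↦ cutoffProj_eq_zero_of_hasEigenvector hSA hμ hev heven


/-! ## §6 The functions `η_n = 𝓕 ξ_n` as classical solutions on `ℝ` -/

/-- Differentiation under the integral sign: `d/dw ∫_{−λ}^{λ} φ(x) cos(2πxw) dx = ∫ φ(x)(−2πx) sin(2πxw) dx`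
for `φ` continuous on `[−λ, λ]` (same computation as in `ProlateProjectionsProofs`). [folklore] -/
private theorem hasDerivAt_integral_mul_cos {φ : ℝ → ℝ} {lam : ℝ} (hlam : 0 < lam)
    (hφ : ContinuousOn φ (Icc (-lam) lam)) (w₀ : ℝ) :
    HasDerivAt (fun w ↦ ∫ x in (-lam)..lam, φ x * Real.cos (2 * π * x * w))
      (∫ x in (-lam)..lam, φ x * (-(2 * π * x) * Real.sin (2 * π * x * w₀))) w₀ := by
  have hle : -lam ≤ lam := by linarith
  have hIoc : uIoc (-lam) lam ⊆ Icc (-lam) lam := by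
    rw [uIoc_of_le hle]; exact Ioc_subset_Icc_self
  have hcontF : ∀ w : ℝ, ContinuousOn (fun x ↦ φ x * Real.cos (2 * π * x * w)) (Icc (-lam) lam) :=
    fun w ↦ hφ.mul (by fun_prop)
  have hcontF' : ∀ w : ℝ,
      ContinuousOn (fun x ↦ φ x * (-(2 * π * x) * Real.sin (2 * π * x * w))) (Icc (-lam) lam) :=
    fun w ↦ hφ.mul (by fun_prop)
  have key := intervalIntegral.hasDerivAt_integral_of_dominated_loc_of_deriv_le
    (μ := (volume : Measure ℝ)) (a := -lam) (b := lam) (x₀ := w₀) (s := univ)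
    (F := fun w x ↦ φ x * Real.cos (2 * π * x * w))
    (F' := fun w x ↦ φ x * (-(2 * π * x) * Real.sin (2 * π * x * w)))
    (bound := fun x ↦ |φ x| * (2 * π * lam)) univ_mem
    (Eventually.of_forall fun w ↦
      ((hcontF w).mono hIoc).aestronglyMeasurable measurableSet_uIoc)
    ((hcontF w₀).intervalIntegrable_of_Icc hle)
    (((hcontF' w₀).mono hIoc).aestronglyMeasurable measurableSet_uIoc)
    (Eventually.of_forall fun x hx w _ ↦ by
      have hx' : x ∈ Icc (-lam) lam := hIoc hx
      rw [Real.norm_eq_abs, abs_mul, abs_mul, abs_neg]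
      refine mul_le_mul_of_nonneg_left ?_ (abs_nonneg _)
      have h1 : |2 * π * x| ≤ 2 * π * lam := by
        rw [abs_mul, abs_of_pos (by positivity : (0 : ℝ) < 2 * π)]
        exact mul_le_mul_of_nonneg_left (abs_le.2 ⟨by linarith [hx'.1], hx'.2⟩) (by positivity)
      have h2 : |Real.sin (2 * π * x * w)| ≤ 1 := Real.abs_sin_le_one _
      nlinarith [abs_nonneg (2 * π * x), abs_nonneg (Real.sin (2 * π * x * w))])
    (((hφ.abs).mul continuousOn_const).intervalIntegrable_of_Icc hle)
    (Eventually.of_forall fun x _ w _ ↦ by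
      have h := (((hasDerivAt_id w).const_mul (2 * π * x)).cos).const_mul (φ x)
      refine h.congr_deriv ?_
      simp only [id, mul_one]
      ring)
  exact key.2

/-- Differentiation under the integral sign: `d/dw ∫_{−λ}^{λ} φ(x) sin(2πxw) dx = ∫ φ(x)(2πx) cos(2πxw) dx`
for `φ` continuous on `[−λ, λ]`. [folklore] -/
private theorem hasDerivAt_integral_mul_sin {φ : ℝ → ℝ} {lam : ℝ} (hlam : 0 < lam)
    (hφ : ContinuousOn φ (Icc (-lam) lam)) (w₀ : ℝ) :
    HasDerivAt (fun w ↦ ∫ x in (-lam)..lam, φ x * Real.sin (2 * π * x * w))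
      (∫ x in (-lam)..lam, φ x * ((2 * π * x) * Real.cos (2 * π * x * w₀))) w₀ := by
  have hle : -lam ≤ lam := by linarith
  have hIoc : uIoc (-lam) lam ⊆ Icc (-lam) lam := by
    rw [uIoc_of_le hle]; exact Ioc_subset_Icc_self
  have hcontF : ∀ w : ℝ, ContinuousOn (fun x ↦ φ x * Real.sin (2 * π * x * w)) (Icc (-lam) lam) :=
    fun w ↦ hφ.mul (by fun_prop)
  have hcontF' : ∀ w : ℝ,
      ContinuousOn (fun x ↦ φ x * ((2 * π * x) * Real.cos (2 * π * x * w))) (Icc (-lam) lam) :=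
    fun w ↦ hφ.mul (by fun_prop)
  have key := intervalIntegral.hasDerivAt_integral_of_dominated_loc_of_deriv_le
    (μ := (volume : Measure ℝ)) (a := -lam) (b := lam) (x₀ := w₀) (s := univ)
    (F := fun w x ↦ φ x * Real.sin (2 * π * x * w))
    (F' := fun w x ↦ φ x * ((2 * π * x) * Real.cos (2 * π * x * w)))
    (bound := fun x ↦ |φ x| * (2 * π * lam)) univ_mem
    (Eventually.of_forall fun w ↦
      ((hcontF w).mono hIoc).aestronglyMeasurable measurableSet_uIoc)
    ((hcontF w₀).intervalIntegrable_of_Icc hle)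
    (((hcontF' w₀).mono hIoc).aestronglyMeasurable measurableSet_uIoc)
    (Eventually.of_forall fun x hx w _ ↦ by
      have hx' : x ∈ Icc (-lam) lam := hIoc hx
      rw [Real.norm_eq_abs, abs_mul, abs_mul]
      refine mul_le_mul_of_nonneg_left ?_ (abs_nonneg _)
      have h1 : |2 * π * x| ≤ 2 * π * lam := by
        rw [abs_mul, abs_of_pos (by positivity : (0 : ℝ) < 2 * π)]
        exact mul_le_mul_of_nonneg_left (abs_le.2 ⟨by linarith [hx'.1], hx'.2⟩) (by positivity)
      have h2 : |Real.cos (2 * π * x * w)| ≤ 1 := Real.abs_cos_le_one _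
      nlinarith [abs_nonneg (2 * π * x), abs_nonneg (Real.cos (2 * π * x * w))])
    (((hφ.abs).mul continuousOn_const).intervalIntegrable_of_Icc hle)
    (Eventually.of_forall fun x _ w _ ↦ by
      have h := (((hasDerivAt_id w).const_mul (2 * π * x)).sin).const_mul (φ x)
      refine h.congr_deriv ?_
      simp only [id, mul_one]
      ring)
  exact key.2

-- `prolateEtaFun_eq_integral_cos` (`η_n` is the finite cosine transform of `φ_n`) and
-- `prolateEtaFun_neg` (`η_n` is even) are the tree's (`ConnesConsani2021.ProlateTraceIdentities`).

/-- The first derivative of `η_n`: `η_n′(w) = ∫_{−1}^{1} φ_n(x)(−2πx) sin(2πxw) dx`. [folklore] -/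
private theorem hasDerivAt_prolateEtaFun (n : ℕ) (w : ℝ) :
    HasDerivAt (prolateEtaFun n)
      ((∫ x in (-1 : ℝ)..1, prolateFun n x * (-(2 * π * x) * Real.sin (2 * π * x * w)) : ℝ) : ℂ) w := by
  have hfc : ContinuousOn (prolateFun n) (Icc (-1 : ℝ) 1) :=
    (isProlateFunction_prolateFun n).contDiffOn.continuousOn
  have h := (hasDerivAt_integral_mul_cos one_pos (by simpa using hfc) w).ofReal_comp
  have e : (fun w ↦ ((∫ x in (-1 : ℝ)..1, prolateFun n x * Real.cos (2 * π * x * w) : ℝ) : ℂ)) =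
      prolateEtaFun n := by
    funext w; rw [prolateEtaFun_eq_integral_cos]
  rw [← e]
  simpa using h

/-- The derivative of `η_n′`: `η_n″(w) = ∫_{−1}^{1} φ_n(x)(−2πx)(2πx) cos(2πxw) dx`. [folklore] -/
private theorem hasDerivAt_deriv_prolateEtaFun (n : ℕ) (w : ℝ) :
    HasDerivAt (deriv (prolateEtaFun n))
      ((∫ x in (-1 : ℝ)..1, (prolateFun n x * (-(2 * π * x))) * ((2 * π * x) *
        Real.cos (2 * π * x * w)) : ℝ) : ℂ) w := by
  have hfc : ContinuousOn (fun x ↦ prolateFun n x * (-(2 * π * x))) (Icc (-(1 : ℝ)) 1) :=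
    (isProlateFunction_prolateFun n).contDiffOn.continuousOn.mul (by fun_prop)
  have h := (hasDerivAt_integral_mul_sin one_pos hfc w).ofReal_comp
  have e : (fun w ↦ ((∫ x in (-(1 : ℝ))..1, (prolateFun n x * (-(2 * π * x))) *
      Real.sin (2 * π * x * w) : ℝ) : ℂ)) = deriv (prolateEtaFun n) := by
    funext w
    rw [(hasDerivAt_prolateEtaFun n w).deriv]
    congr 1
    refine intervalIntegral.integral_congr fun x _ ↦ ?_
    ring
  rw [← e]
  exact h

/-- `η_n` is `C²` on `ℝ` ("smooth, as the Fourier transform of a function with compact support").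
[cite: ConnesConsani2021, Remark 4.6 (i) §4 p. 18 (arXiv p0018:L5)] -/
theorem contDiff_two_prolateEtaFun (n : ℕ) : ContDiff ℝ 2 (prolateEtaFun n) := by
  have hd1 : Differentiable ℝ (prolateEtaFun n) := fun w ↦
    (hasDerivAt_prolateEtaFun n w).differentiableAt
  have hd2 : Differentiable ℝ (deriv (prolateEtaFun n)) := fun w ↦
    (hasDerivAt_deriv_prolateEtaFun n w).differentiableAt
  -- the second derivative is again a parametric integral of the same type, hence differentiable
  have hfc : ContinuousOn (fun x ↦ prolateFun n x * (-(2 * π * x)) * (2 * π * x)) (Icc (-(1 : ℝ)) 1) :=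
    ((isProlateFunction_prolateFun n).contDiffOn.continuousOn.mul (by fun_prop)).mul (by fun_prop)
  have e : deriv (deriv (prolateEtaFun n)) = fun w ↦ ((∫ x in (-(1 : ℝ))..1,
      (prolateFun n x * (-(2 * π * x)) * (2 * π * x)) * Real.cos (2 * π * x * w) : ℝ) : ℂ) := by
    funext w
    rw [(hasDerivAt_deriv_prolateEtaFun n w).deriv]
    congr 1
    refine intervalIntegral.integral_congr fun x _ ↦ ?_
    ring
  have hd3 : Continuous (deriv (deriv (prolateEtaFun n))) := by
    rw [e]
    exact continuous_iff_continuousAt.mpr fun w ↦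
      ((hasDerivAt_integral_mul_cos one_pos hfc w).ofReal_comp).continuousAt
  rw [show (2 : WithTop ℕ∞) = 1 + 1 from rfl, contDiff_succ_iff_deriv]
  exact ⟨hd1, by simp, contDiff_one_iff_deriv.mpr ⟨hd2, hd3⟩⟩

/-- **`W η_n = χ_n η_n` on all of `ℝ`**: the cosine transform intertwines the prolate operator
(tree theorem `IsProlateFunction.integral_mul_cos_ode`, Slepian's "lucky accident").
[cite: ConnesConsani2021, §4 p. 16 eq. (prolateeq) (arXiv p0016:L17–L28); SlepianPollak1961, §III] -/
theorem prolateWaveOpFun_prolateEtaFun (n : ℕ) {χ : ℝ}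
    (hχ : ∀ x ∈ Ioo (-1 : ℝ) 1,
      -(deriv (fun y ↦ ((1 : ℝ) ^ 2 - y ^ 2) * deriv (prolateFun n) y) x) +
        (2 * π * 1 * x) ^ 2 * prolateFun n x = χ * prolateFun n x) (w : ℝ) :
    prolateWaveOpFun 1 (prolateEtaFun n) w = (χ : ℂ) * prolateEtaFun n w := by
  set c : ℝ → ℝ := fun w ↦ ∫ x in (-(1 : ℝ))..1, prolateFun n x * Real.cos (2 * π * x * w) with hc
  set c₁ : ℝ → ℝ := fun w ↦
    ∫ x in (-(1 : ℝ))..1, prolateFun n x * (-(2 * π * x) * Real.sin (2 * π * x * w)) with hc₁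
  set c₂ : ℝ → ℝ := fun w ↦ ∫ x in (-(1 : ℝ))..1,
    (prolateFun n x * (-(2 * π * x))) * ((2 * π * x) * Real.cos (2 * π * x * w)) with hc₂
  have hode := (isProlateFunction_prolateFun n).integral_mul_cos_ode hχ w
  -- `hode : (1^2 − w²) c₂ w = 2w c₁ w + ((2π·1·w)² − χ) c w`
  have hη : ∀ w, prolateEtaFun n w = ((c w : ℝ) : ℂ) := fun w ↦ by
    rw [prolateEtaFun_eq_integral_cos]
  have hη1 : ∀ w, deriv (prolateEtaFun n) w = ((c₁ w : ℝ) : ℂ) := fun w ↦ by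
    rw [(hasDerivAt_prolateEtaFun n w).deriv]
  have hη2 : ∀ w, HasDerivAt (deriv (prolateEtaFun n)) ((c₂ w : ℝ) : ℂ) w := fun w ↦ by
    have := hasDerivAt_deriv_prolateEtaFun n w; simpa [hc₂] using this
  -- derivative of `p · η′`
  have hp : HasDerivAt (fun y : ℝ ↦ (((1 : ℝ) ^ 2 - y ^ 2 : ℝ) : ℂ)) (((-(2 * w) : ℝ) : ℂ)) w := by
    have := ((hasDerivAt_pow 2 w).const_sub ((1 : ℝ) ^ 2)).ofReal_comp
    refine this.congr_deriv ?_
    push_cast; ring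
  have hprod : HasDerivAt (fun y : ℝ ↦ (((1 : ℝ) ^ 2 - y ^ 2 : ℝ) : ℂ) * deriv (prolateEtaFun n) y)
      (((-(2 * w) : ℝ) : ℂ) * deriv (prolateEtaFun n) w +
        (((1 : ℝ) ^ 2 - w ^ 2 : ℝ) : ℂ) * ((c₂ w : ℝ) : ℂ)) w := hp.mul (hη2 w)
  rw [prolateWaveOpFun, hprod.deriv, hη1, hη]
  have hode' : ((1 : ℝ) ^ 2 - w ^ 2) * c₂ w = 2 * w * c₁ w + ((2 * π * 1 * w) ^ 2 - χ) * c w := hode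
  have : (((1 : ℝ) ^ 2 - w ^ 2 : ℝ) : ℂ) * ((c₂ w : ℝ) : ℂ) =
      ((2 * w * c₁ w + ((2 * π * 1 * w) ^ 2 - χ) * c w : ℝ) : ℂ) := by
    rw [← Complex.ofReal_mul, hode']
  rw [this]
  push_cast; ring


/-! ## §7 A priori decay at `+∞` of solutions of `W g = μ g`, `μ < 0` -/
/-- **A priori decay `y, y′ = O(1/x)` at `+∞`** for real `C²` solutions on `(1, ∞)` of the prolate
equation `(x² − 1)y″ + 2xy′ + (4π²x² − μ)y = 0` with `μ < 0`: for `u = xy` one has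
`u″ = −a u′ − k u` with `a = 2/(x(x² − 1)) > 0` and `k = (4π²x⁴ − μx² − 2)/(x⁴ − x²) ≥ 4π²`
decreasing, so the energy `u′² + k u²` is non-increasing. [folklore] -/
private theorem decay_of_ode_real {μ : ℝ} (hμ : μ < 0) {y : ℝ → ℝ} (hy : ContDiffOn ℝ 2 y (Ioi 1))
    (hode : ∀ x, 1 < x →
      (x ^ 2 - 1) * deriv (deriv y) x + 2 * x * deriv y x + (4 * π ^ 2 * x ^ 2 - μ) * y x = 0) :
    ∃ C, ∀ x, 2 ≤ x → |x * y x| ≤ C ∧ |x * deriv y x| ≤ C := by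
  -- derivatives of `y` and `y′` on `(1, ∞)`
  have hy1 : ∀ x, 1 < x → HasDerivAt y (deriv y x) x := fun x hx ↦
    ((hy.differentiableOn (by norm_num) x hx).differentiableAt (Ioi_mem_nhds hx)).hasDerivAt
  have hdy : ContDiffOn ℝ 1 (deriv y) (Ioi 1) := hy.deriv_of_isOpen isOpen_Ioi (by norm_num)
  have hy2 : ∀ x, 1 < x → HasDerivAt (deriv y) (deriv (deriv y) x) x := fun x hx ↦
    ((hdy.differentiableOn (by norm_num) x hx).differentiableAt (Ioi_mem_nhds hx)).hasDerivAt
  -- `u = x y`, `u₁ = u′`, `u₂ = u″`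
  set u : ℝ → ℝ := fun x ↦ x * y x with hu
  set u₁ : ℝ → ℝ := fun x ↦ y x + x * deriv y x with hu₁
  set u₂ : ℝ → ℝ := fun x ↦ 2 * deriv y x + x * deriv (deriv y) x with hu₂
  have hdu : ∀ x, 1 < x → HasDerivAt u (u₁ x) x := fun x hx ↦ by
    have h := (hasDerivAt_id x).mul (hy1 x hx)
    have e : u = (id * y : ℝ → ℝ) := by funext t; simp [hu]
    rw [e]; refine h.congr_deriv ?_; simp [hu₁]
  have hdu₁ : ∀ x, 1 < x → HasDerivAt u₁ (u₂ x) x := fun x hx ↦ by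
    have h := (hy1 x hx).add ((hasDerivAt_id x).mul (hy2 x hx))
    have e : u₁ = (y + id * deriv y : ℝ → ℝ) := by funext t; simp [hu₁]
    rw [e]; refine h.congr_deriv ?_; simp only [hu₂, id, one_mul]; ring
  -- the coefficient `k` and its derivative
  set P : ℝ → ℝ := fun x ↦ 4 * π ^ 2 * x ^ 4 - μ * x ^ 2 - 2 with hP
  set Q : ℝ → ℝ := fun x ↦ x ^ 4 - x ^ 2 with hQ
  set P' : ℝ → ℝ := fun x ↦ 16 * π ^ 2 * x ^ 3 - 2 * μ * x with hP'
  set Q' : ℝ → ℝ := fun x ↦ 4 * x ^ 3 - 2 * x with hQ'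
  set k : ℝ → ℝ := fun x ↦ P x / Q x with hk
  set k' : ℝ → ℝ := fun x ↦ (P' x * Q x - P x * Q' x) / Q x ^ 2 with hk'
  have hQpos : ∀ x, 1 < x → 0 < Q x := fun x hx ↦ by
    simp only [hQ]
    rw [show x ^ 4 - x ^ 2 = x ^ 2 * (x ^ 2 - 1) by ring]
    exact mul_pos (by positivity) (by nlinarith)
  have hdk : ∀ x, 1 < x → HasDerivAt k (k' x) x := fun x hx ↦ by
    have hP1 : HasDerivAt P (P' x) x := by
      simp only [hP, hP']
      have := (((hasDerivAt_pow 4 x).const_mul (4 * π ^ 2)).sub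
        ((hasDerivAt_pow 2 x).const_mul μ)).sub_const 2
      refine this.congr_deriv ?_
      push_cast; ring
    have hQ1 : HasDerivAt Q (Q' x) x := by
      simp only [hQ, hQ']
      have := (hasDerivAt_pow 4 x).sub (hasDerivAt_pow 2 x)
      refine this.congr_deriv ?_
      push_cast; ring
    exact hP1.div hQ1 (hQpos x hx).ne'
  have hk'neg : ∀ x, 1 < x → k' x ≤ 0 := fun x hx ↦ by
    simp only [hk', hP, hP', hQ, hQ']
    apply div_nonpos_of_nonpos_of_nonneg _ (sq_nonneg _)
    have hx0 : 0 < x := by linarith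
    have hpx : 1 < π * x := by
      have := mul_lt_mul_of_pos_left hx Real.pi_pos
      linarith [Real.pi_gt_three]
    have h1 : 1 < π ^ 2 * x ^ 2 := by
      rw [show π ^ 2 * x ^ 2 = (π * x) * (π * x) by ring]
      nlinarith
    have h2 : (16 * π ^ 2 * x ^ 3 - 2 * μ * x) * (x ^ 4 - x ^ 2) -
        (4 * π ^ 2 * x ^ 4 - μ * x ^ 2 - 2) * (4 * x ^ 3 - 2 * x) =
        x * (x ^ 2 * (8 - 8 * (π ^ 2 * x ^ 2) + 2 * μ * x ^ 2) - 4) := by ring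
    rw [h2]
    have hμx : μ * x ^ 2 < 0 := mul_neg_of_neg_of_pos hμ (by positivity)
    have h3a : 8 - 8 * (π ^ 2 * x ^ 2) + 2 * μ * x ^ 2 < 0 := by linarith
    have h3 : x ^ 2 * (8 - 8 * (π ^ 2 * x ^ 2) + 2 * μ * x ^ 2) - 4 < 0 := by
      have := mul_neg_of_pos_of_neg (by positivity : (0 : ℝ) < x ^ 2) h3a
      linarith
    exact (mul_neg_of_pos_of_neg hx0 h3).le
  have hkge : ∀ x, 1 < x → 4 * π ^ 2 ≤ k x := fun x hx ↦ by
    have hQ' := hQpos x hx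
    simp only [hQ] at hQ'
    simp only [hk, hP, hQ]
    rw [le_div_iff₀ hQ']
    have hx2 : 1 < x ^ 2 := by nlinarith
    have hμx : μ * x ^ 2 < 0 := mul_neg_of_neg_of_pos hμ (by positivity)
    nlinarith [Real.pi_gt_three, Real.pi_pos, mul_pos Real.pi_pos Real.pi_pos]
  -- the energy and its derivative
  set E : ℝ → ℝ := fun x ↦ u₁ x ^ 2 + k x * u x ^ 2 with hE
  set D : ℝ → ℝ := fun x ↦ 2 * u₁ x * u₂ x + (k' x * u x ^ 2 + k x * (2 * u x * u₁ x)) with hD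
  have hdE : ∀ x, 1 < x → HasDerivAt E (D x) x := fun x hx ↦ by
    have h1 : HasDerivAt (fun x ↦ u₁ x ^ 2) (2 * u₁ x * u₂ x) x := by
      have := (hdu₁ x hx).pow 2
      refine this.congr_deriv ?_
      simp
    have h2 : HasDerivAt (fun x ↦ k x * u x ^ 2) (k' x * u x ^ 2 + k x * (2 * u x * u₁ x)) x := by
      have := (hdk x hx).mul ((hdu x hx).pow 2)
      refine this.congr_deriv ?_
      simp
    exact h1.add h2
  have hDle : ∀ x, 1 < x → D x ≤ 0 := fun x hx ↦ by
    have hx0 : x ≠ 0 := by positivity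
    have hx1 : x ^ 2 - 1 ≠ 0 := by nlinarith
    have hQx : Q x ≠ 0 := (hQpos x hx).ne'
    have hy2' : deriv (deriv y) x =
        (-(2 * x * deriv y x) - (4 * π ^ 2 * x ^ 2 - μ) * y x) / (x ^ 2 - 1) := by
      rw [eq_div_iff hx1]; linarith [hode x hx]
    have hkey : u₂ x + k x * u x = -2 * u₁ x / (x * (x ^ 2 - 1)) := by
      simp only [hu, hu₁, hu₂, hk, hP, hQ]
      rw [hy2']
      field_simp
      ring
    have hD' : D x = -4 * u₁ x ^ 2 / (x * (x ^ 2 - 1)) + k' x * u x ^ 2 := by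
      have : D x = 2 * u₁ x * (u₂ x + k x * u x) + k' x * u x ^ 2 := by simp only [hD]; ring
      rw [this, hkey]; field_simp; ring
    rw [hD']
    have h1 : -4 * u₁ x ^ 2 / (x * (x ^ 2 - 1)) ≤ 0 :=
      div_nonpos_of_nonpos_of_nonneg (by nlinarith [sq_nonneg (u₁ x)])
        (by nlinarith : 0 ≤ x * (x ^ 2 - 1))
    nlinarith [hk'neg x hx, sq_nonneg (u x)]
  -- `E` is non-increasing on `[2, ∞)`
  have hanti : AntitoneOn E (Ici 2) := by
    have hcont : ContinuousOn E (Ici 2) := fun x hx ↦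
      (hdE x (by linarith [mem_Ici.mp hx])).continuousAt.continuousWithinAt
    refine antitoneOn_of_deriv_nonpos (convex_Ici 2) hcont ?_ ?_
    · rw [interior_Ici]
      exact fun x hx ↦ (hdE x (by linarith [mem_Ioi.mp hx])).differentiableAt.differentiableWithinAt
    · rw [interior_Ici]
      intro x hx
      rw [(hdE x (by linarith [mem_Ioi.mp hx])).deriv]
      exact hDle x (by linarith [mem_Ioi.mp hx])
  -- conclusion
  have hE2 : 0 ≤ E 2 := by
    simp only [hE]; nlinarith [sq_nonneg (u₁ 2), sq_nonneg (u 2), hkge 2 (by norm_num)]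
  refine ⟨2 * Real.sqrt (E 2), fun x hx ↦ ?_⟩
  have hx1 : 1 < x := by linarith
  have hEx : E x ≤ E 2 := hanti (mem_Ici.mpr le_rfl) (mem_Ici.mpr hx) hx
  have hs0 : 0 ≤ Real.sqrt (E 2) := Real.sqrt_nonneg _
  have hEx' : u₁ x ^ 2 + k x * u x ^ 2 ≤ E 2 := hEx
  have hk1 : 1 ≤ k x := le_trans (by nlinarith [Real.pi_gt_three]) (hkge x hx1)
  have hu2 : u x ^ 2 ≤ E 2 := by
    nlinarith [sq_nonneg (u₁ x), mul_nonneg (by linarith : 0 ≤ k x - 1) (sq_nonneg (u x))]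
  have hu12 : u₁ x ^ 2 ≤ E 2 := by
    nlinarith [mul_nonneg (by linarith : 0 ≤ k x) (sq_nonneg (u x))]
  have hux : |u x| ≤ Real.sqrt (E 2) := Real.abs_le_sqrt hu2
  have hu₁x : |u₁ x| ≤ Real.sqrt (E 2) := Real.abs_le_sqrt hu12
  have hyx : |y x| ≤ |u x| := by
    simp only [hu]; rw [abs_mul, abs_of_pos (by linarith : (0 : ℝ) < x)]
    nlinarith [abs_nonneg (y x)]
  refine ⟨by simpa [hu] using hux.trans (by linarith), ?_⟩
  have : x * deriv y x = u₁ x - y x := by simp only [hu₁]; ring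
  rw [this]
  calc |u₁ x - y x| ≤ |u₁ x| + |y x| := abs_sub _ _
    _ ≤ Real.sqrt (E 2) + Real.sqrt (E 2) := add_le_add hu₁x (hyx.trans hux)
    _ = 2 * Real.sqrt (E 2) := by ring

/-- The prolate equation `W g = μ g` on `(1, ∞)` in expanded form:
`(x² − 1) g″ + 2x g′ + (4π²x² − μ) g = 0`. [folklore] -/
private theorem expanded_ode_of_prolateWave_eq {μ : ℝ} {g : ℝ → ℂ} (hg : ContDiffOn ℝ ∞ g (Ioi 1))
    (hode : ∀ x, 1 < x → prolateWaveOpFun 1 g x = μ * g x) {x : ℝ} (hx : 1 < x) :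
    ((x ^ 2 - 1 : ℝ) : ℂ) * deriv (deriv g) x + ((2 * x : ℝ) : ℂ) * deriv g x +
      ((4 * π ^ 2 * x ^ 2 - μ : ℝ) : ℂ) * g x = 0 := by
  have hdg : ContDiffOn ℝ ∞ (deriv g) (Ioi 1) := hg.deriv_of_isOpen isOpen_Ioi (by simp)
  have h2 : HasDerivAt (deriv g) (deriv (deriv g) x) x :=
    ((hdg.differentiableOn (by simp) x hx).differentiableAt (Ioi_mem_nhds hx)).hasDerivAt
  have hp : HasDerivAt (fun y : ℝ ↦ (((1 : ℝ) ^ 2 - y ^ 2 : ℝ) : ℂ)) (((-(2 * x) : ℝ) : ℂ)) x := by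
    have := ((hasDerivAt_pow 2 x).const_sub ((1 : ℝ) ^ 2)).ofReal_comp
    refine this.congr_deriv ?_
    push_cast; ring
  have hprod : HasDerivAt (fun y : ℝ ↦ (((1 : ℝ) ^ 2 - y ^ 2 : ℝ) : ℂ) * deriv g y)
      (((-(2 * x) : ℝ) : ℂ) * deriv g x + (((1 : ℝ) ^ 2 - x ^ 2 : ℝ) : ℂ) * deriv (deriv g) x) x :=
    hp.mul h2
  have hW := hode x hx
  rw [prolateWaveOpFun, hprod.deriv] at hW
  have : ((x ^ 2 - 1 : ℝ) : ℂ) * deriv (deriv g) x + ((2 * x : ℝ) : ℂ) * deriv g x +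
      ((4 * π ^ 2 * x ^ 2 - μ : ℝ) : ℂ) * g x =
      (-(((-(2 * x) : ℝ) : ℂ) * deriv g x + (((1 : ℝ) ^ 2 - x ^ 2 : ℝ) : ℂ) * deriv (deriv g) x) +
        ((2 * π * 1 * x : ℝ) : ℂ) ^ 2 * g x) - (μ : ℂ) * g x := by
    push_cast; ring
  rw [this, hW]; ring

/-- Real and imaginary parts of a solution of `W g = μ g` on `(1, ∞)` solve the real expanded
equation. [folklore] -/
private theorem real_ode_of_prolateWave_eq {μ : ℝ} {g : ℝ → ℂ} (hg : ContDiffOn ℝ ∞ g (Ioi 1))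
    (hode : ∀ x, 1 < x → prolateWaveOpFun 1 g x = μ * g x) (L : ℂ →L[ℝ] ℝ)
    (hL : ∀ (r : ℝ) (z : ℂ), L ((r : ℂ) * z) = r * L z) :
    ContDiffOn ℝ 2 (fun x ↦ L (g x)) (Ioi 1) ∧
      ∀ x, 1 < x → (x ^ 2 - 1) * deriv (deriv fun x ↦ L (g x)) x +
        2 * x * deriv (fun x ↦ L (g x)) x + (4 * π ^ 2 * x ^ 2 - μ) * L (g x) = 0 := by
  have hdg : ContDiffOn ℝ ∞ (deriv g) (Ioi 1) := hg.deriv_of_isOpen isOpen_Ioi (by simp)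
  have h1 : ∀ x, 1 < x → HasDerivAt g (deriv g x) x := fun x hx ↦
    ((hg.differentiableOn (by simp) x hx).differentiableAt (Ioi_mem_nhds hx)).hasDerivAt
  have h2 : ∀ x, 1 < x → HasDerivAt (deriv g) (deriv (deriv g) x) x := fun x hx ↦
    ((hdg.differentiableOn (by simp) x hx).differentiableAt (Ioi_mem_nhds hx)).hasDerivAt
  have hd1 : ∀ x, 1 < x → deriv (fun x ↦ L (g x)) x = L (deriv g x) := fun x hx ↦
    (L.hasFDerivAt.comp_hasDerivAt x (h1 x hx)).deriv
  have hd2 : ∀ x, 1 < x → deriv (deriv fun x ↦ L (g x)) x = L (deriv (deriv g) x) := by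
    intro x hx
    have hev : deriv (fun x ↦ L (g x)) =ᶠ[𝓝 x] fun x ↦ L (deriv g x) := by
      filter_upwards [Ioi_mem_nhds hx] with t ht using hd1 t ht
    rw [hev.deriv_eq]
    exact (L.hasFDerivAt.comp_hasDerivAt x (h2 x hx)).deriv
  refine ⟨L.contDiff.comp_contDiffOn (hg.of_le (by norm_cast)), fun x hx ↦ ?_⟩
  have h := congrArg L (expanded_ode_of_prolateWave_eq hg hode hx)
  rw [map_zero, map_add, map_add, hL, hL, hL] at h
  rw [hd2 x hx, hd1 x hx]
  exact h

/-- **Decay at `+∞`**: a `C^∞` solution of `W g = μ g` (`μ < 0`) on `(1, ∞)` satisfies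
`|g(x)|, |g′(x)| ≤ C/x` for `x ≥ 2`. [folklore] -/
private theorem decay_of_prolateWave_eq {μ : ℝ} (hμ : μ < 0) {g : ℝ → ℂ}
    (hg : ContDiffOn ℝ ∞ g (Ioi 1)) (hode : ∀ x, 1 < x → prolateWaveOpFun 1 g x = μ * g x) :
    ∃ C, ∀ x, 2 ≤ x → ‖g x‖ ≤ C / x ∧ ‖deriv g x‖ ≤ C / x := by
  have hre := real_ode_of_prolateWave_eq hg hode Complex.reCLM
    (fun r z ↦ by simp [Complex.reCLM_apply])
  have him := real_ode_of_prolateWave_eq hg hode Complex.imCLM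
    (fun r z ↦ by simp [Complex.imCLM_apply])
  obtain ⟨C₁, hC₁⟩ := decay_of_ode_real hμ hre.1 hre.2
  obtain ⟨C₂, hC₂⟩ := decay_of_ode_real hμ him.1 him.2
  have h1 : ∀ x, 1 < x → HasDerivAt g (deriv g x) x := fun x hx ↦
    ((hg.differentiableOn (by simp) x hx).differentiableAt (Ioi_mem_nhds hx)).hasDerivAt
  refine ⟨C₁ + C₂, fun x hx ↦ ?_⟩
  have hx0 : 0 < x := by linarith
  obtain ⟨ha, hb⟩ := hC₁ x hx
  obtain ⟨hc, hd⟩ := hC₂ x hx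
  simp only [Complex.reCLM_apply, Complex.imCLM_apply] at ha hb hc hd
  have hdre : deriv (fun x ↦ (g x).re) x = (deriv g x).re :=
    (Complex.reCLM.hasFDerivAt.comp_hasDerivAt x (h1 x (by linarith))).deriv
  have hdim : deriv (fun x ↦ (g x).im) x = (deriv g x).im :=
    (Complex.imCLM.hasFDerivAt.comp_hasDerivAt x (h1 x (by linarith))).deriv
  rw [hdre] at hb
  rw [hdim] at hd
  rw [abs_mul, abs_of_pos hx0] at ha hb hc hd
  constructor
  · rw [le_div_iff₀ hx0]
    calc ‖g x‖ * x ≤ (|(g x).re| + |(g x).im|) * x :=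
          mul_le_mul_of_nonneg_right (Complex.norm_le_abs_re_add_abs_im _) hx0.le
      _ = x * |(g x).re| + x * |(g x).im| := by ring
      _ ≤ C₁ + C₂ := add_le_add ha hc
  · rw [le_div_iff₀ hx0]
    calc ‖deriv g x‖ * x ≤ (|(deriv g x).re| + |(deriv g x).im|) * x :=
          mul_le_mul_of_nonneg_right (Complex.norm_le_abs_re_add_abs_im _) hx0.le
      _ = x * |(deriv g x).re| + x * |(deriv g x).im| := by ring
      _ ≤ C₁ + C₂ := add_le_add hb hd


/-! ## §8 Asymptotics of `η_n` at `∞` and the boundary Wronskians on `(1, ∞)` -/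

/-- **Riemann–Lebesgue on `[−1, 1]`**: for `u` continuous on `[−1, 1]`, the finite cosine and sine
transforms `∫_{−1}^{1} u(x) cos(2πxw) dx`, `∫_{−1}^{1} u(x) sin(2πxw) dx` tend to `0` as `w → +∞`
(Mathlib's `Real.zero_at_infty_fourier` for `1_{[−1,1]} u`). [folklore] -/
private theorem tendsto_integral_mul_cos_sin {u : ℝ → ℝ} (hu : ContinuousOn u (Icc (-1 : ℝ) 1)) :
    Tendsto (fun w : ℝ ↦ ∫ x in (-1 : ℝ)..1, u x * Real.cos (2 * π * x * w)) atTop (𝓝 0) ∧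
      Tendsto (fun w : ℝ ↦ ∫ x in (-1 : ℝ)..1, u x * Real.sin (2 * π * x * w)) atTop (𝓝 0) := by
  set U : ℝ → ℂ := (Icc (-1 : ℝ) 1).indicator fun x ↦ (u x : ℂ) with hU
  have hRL : Tendsto (fun w : ℝ ↦ 𝓕 U w) atTop (𝓝 0) :=
    (Real.zero_at_infty_fourier U).mono_left atTop_le_cocompact
  have hc1 : ∀ w : ℝ, ContinuousOn (fun x : ℝ ↦ ((u x * Real.cos (2 * π * x * w) : ℝ) : ℂ))
      (Icc (-1 : ℝ) 1) := fun w ↦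
    Complex.continuous_ofReal.comp_continuousOn (hu.mul (by fun_prop))
  have hc2 : ∀ w : ℝ, ContinuousOn (fun x : ℝ ↦ ((u x * Real.sin (2 * π * x * w) : ℝ) : ℂ) * I)
      (Icc (-1 : ℝ) 1) := fun w ↦
    (Complex.continuous_ofReal.comp_continuousOn (hu.mul (by fun_prop))).mul continuousOn_const
  have hF : ∀ w : ℝ, 𝓕 U w = ((∫ x in (-1 : ℝ)..1, u x * Real.cos (2 * π * x * w) : ℝ) : ℂ) -
      ((∫ x in (-1 : ℝ)..1, u x * Real.sin (2 * π * x * w) : ℝ) : ℂ) * I := by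
    intro w
    rw [Real.fourier_real_eq_integral_exp_smul]
    have e1 : (fun v : ℝ ↦ cexp (↑(-2 * π * v * w) * I) • U v) =
        (Icc (-1 : ℝ) 1).indicator (fun v ↦ (u v : ℂ) * cexp (↑(-2 * π * v * w) * I)) := by
      funext v
      simp only [hU, smul_eq_mul]
      by_cases hv : v ∈ Icc (-1 : ℝ) 1
      · rw [indicator_of_mem hv, indicator_of_mem hv, mul_comm]
      · rw [indicator_of_notMem hv, indicator_of_notMem hv, mul_zero]
    rw [e1, integral_indicator measurableSet_Icc, integral_Icc_eq_integral_Ioc,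
      ← intervalIntegral.integral_of_le (by norm_num : (-1 : ℝ) ≤ 1)]
    have e : (fun x : ℝ ↦ (u x : ℂ) * cexp (↑(-2 * π * x * w) * I))
        = fun x : ℝ ↦ ((u x * Real.cos (2 * π * x * w) : ℝ) : ℂ)
          - ((u x * Real.sin (2 * π * x * w) : ℝ) : ℂ) * I := by
      funext x
      rw [Complex.exp_mul_I, ← Complex.ofReal_cos, ← Complex.ofReal_sin,
        show -2 * π * x * w = -(2 * π * x * w) by ring, Real.cos_neg, Real.sin_neg]
      push_cast; ring
    rw [e, intervalIntegral.integral_sub ((hc1 w).intervalIntegrable_of_Icc (by norm_num))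
        ((hc2 w).intervalIntegrable_of_Icc (by norm_num)), intervalIntegral.integral_mul_const,
      intervalIntegral.integral_ofReal, intervalIntegral.integral_ofReal]
  constructor
  · have h := (Complex.continuous_re.tendsto 0).comp hRL
    rw [Complex.zero_re] at h
    refine h.congr' (Eventually.of_forall fun w ↦ ?_)
    simp only [Function.comp_apply, hF w, Complex.sub_re, Complex.ofReal_re, Complex.mul_re,
      Complex.I_re, Complex.I_im, Complex.ofReal_im]
    ring
  · have h := ((Complex.continuous_im.tendsto 0).comp hRL).neg
    rw [Complex.zero_im, neg_zero] at h
    refine h.congr' (Eventually.of_forall fun w ↦ ?_)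
    simp only [Function.comp_apply, hF w, Complex.sub_im, Complex.ofReal_im, Complex.mul_im,
      Complex.I_re, Complex.I_im, Complex.ofReal_re]
    ring

/-- The derivative of `φ_n` within `[−1, 1]` (continuous up to the boundary). [folklore] -/
private theorem continuousOn_derivWithin_prolateFun (n : ℕ) :
    ContinuousOn (derivWithin (prolateFun n) (Icc (-1 : ℝ) 1)) (Icc (-1 : ℝ) 1) :=
  (isProlateFunction_prolateFun n).contDiffOn.continuousOn_derivWithin
    (uniqueDiffOn_Icc (by norm_num)) (by norm_num)

/-- `φ_n` is differentiable on `(−1, 1)` with derivative the derivative within `[−1, 1]`. [folklore] -/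
private theorem hasDerivAt_prolateFun (n : ℕ) {x : ℝ} (hx : x ∈ Ioo (-1 : ℝ) 1) :
    HasDerivAt (prolateFun n) (derivWithin (prolateFun n) (Icc (-1 : ℝ) 1) x) x :=
  ((isProlateFunction_prolateFun n).contDiffOn.differentiableOn (by norm_num) x
    (Ioo_subset_Icc_self hx)).hasDerivWithinAt.hasDerivAt (Icc_mem_nhds hx.1 hx.2)

/-- **One integration by parts for `η_n`**: for `w ≠ 0`,
`η_n(w) = φ_n(1) sin(2πw)/(πw) − (2πw)⁻¹ ∫_{−1}^{1} φ_n′(x) sin(2πxw) dx` — the leading term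
`sin(2πλy)/y` of the paper. [cite: ConnesMoscovici2022, §2 ¶2 (= arXiv §3, chunk p0008:L7–L12)] -/
theorem prolateEtaFun_eq_sin_div_add (n : ℕ) {w : ℝ} (hw : w ≠ 0) :
    prolateEtaFun n w = ((prolateFun n 1 * Real.sin (2 * π * w) / (π * w) -
      (∫ x in (-1 : ℝ)..1, derivWithin (prolateFun n) (Icc (-1 : ℝ) 1) x * Real.sin (2 * π * x * w)) /
        (2 * π * w) : ℝ) : ℂ) := by
  set f := prolateFun n with hf
  set f₁ := derivWithin (prolateFun n) (Icc (-1 : ℝ) 1) with hf₁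
  have hfc : ContinuousOn f (Icc (-1 : ℝ) 1) := (isProlateFunction_prolateFun n).contDiffOn.continuousOn
  have hf₁c : ContinuousOn f₁ (Icc (-1 : ℝ) 1) := continuousOn_derivWithin_prolateFun n
  -- `d/dx [f sin(2πxw)] = f₁ sin(2πxw) + 2πw f cos(2πxw)` on `(−1, 1)`
  have hF : ∀ x ∈ Ioo (-1 : ℝ) 1, HasDerivAt (fun x ↦ f x * Real.sin (2 * π * x * w))
      (f₁ x * Real.sin (2 * π * x * w) + f x * (2 * π * w * Real.cos (2 * π * x * w))) x := by
    intro x hx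
    have hs : HasDerivAt (fun x : ℝ ↦ Real.sin (2 * π * x * w))
        (Real.cos (2 * π * x * w) * (2 * π * 1 * w)) x :=
      (((hasDerivAt_id x).const_mul (2 * π)).mul_const w).sin
    have := (hasDerivAt_prolateFun n hx).mul hs
    refine this.congr_deriv ?_
    simp only [hf, hf₁]; ring
  have hi1 : IntervalIntegrable (fun x ↦ f₁ x * Real.sin (2 * π * x * w)) volume (-1) 1 :=
    (hf₁c.mul (by fun_prop)).intervalIntegrable_of_Icc (by norm_num)
  have hi2 : IntervalIntegrable (fun x ↦ f x * (2 * π * w * Real.cos (2 * π * x * w))) volume (-1) 1 :=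
    (hfc.mul (by fun_prop)).intervalIntegrable_of_Icc (by norm_num)
  have hFTC : ∫ x in (-1 : ℝ)..1, (f₁ x * Real.sin (2 * π * x * w) +
      f x * (2 * π * w * Real.cos (2 * π * x * w))) =
      f 1 * Real.sin (2 * π * 1 * w) - f (-1) * Real.sin (2 * π * (-1) * w) :=
    intervalIntegral.integral_eq_sub_of_hasDerivAt_of_le (f := fun x ↦ f x * Real.sin (2 * π * x * w))
      (by norm_num : (-1 : ℝ) ≤ 1) (hfc.mul (by fun_prop)) hF (hi1.add hi2)
  rw [intervalIntegral.integral_add hi1 hi2] at hFTC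
  have e2 : ∫ x in (-1 : ℝ)..1, f x * (2 * π * w * Real.cos (2 * π * x * w)) =
      2 * π * w * ∫ x in (-1 : ℝ)..1, f x * Real.cos (2 * π * x * w) := by
    rw [← intervalIntegral.integral_const_mul]
    refine intervalIntegral.integral_congr fun x _ ↦ ?_
    ring
  rw [e2] at hFTC
  have hb : f 1 * Real.sin (2 * π * 1 * w) - f (-1) * Real.sin (2 * π * (-1) * w) =
      2 * f 1 * Real.sin (2 * π * w) := by
    rw [hf, prolateFun_neg, show 2 * π * (-1 : ℝ) * w = -(2 * π * w) by ring, Real.sin_neg,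
      show 2 * π * (1 : ℝ) * w = 2 * π * w by ring]
    ring
  rw [hb] at hFTC
  rw [prolateEtaFun_eq_integral_cos, ← hf]
  congr 1
  have hπw : 2 * π * w ≠ 0 := mul_ne_zero (mul_ne_zero two_ne_zero Real.pi_ne_zero) hw
  have hπw' : π * w ≠ 0 := mul_ne_zero Real.pi_ne_zero hw
  have hC : ∫ x in (-1 : ℝ)..1, f x * Real.cos (2 * π * x * w) =
      (2 * f 1 * Real.sin (2 * π * w) - ∫ x in (-1 : ℝ)..1, f₁ x * Real.sin (2 * π * x * w)) /
        (2 * π * w) := by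
    rw [eq_div_iff hπw]; linarith [hFTC]
  rw [hC]
  generalize (∫ x in (-1 : ℝ)..1, f₁ x * Real.sin (2 * π * x * w)) = I₁
  field_simp

/-- **One integration by parts for `η_n′`**: for `w ≠ 0`,
`η_n′(w) = 2φ_n(1) cos(2πw)/w − w⁻¹ ∫_{−1}^{1} (φ_n + xφ_n′)(x) cos(2πxw) dx`.
[cite: ConnesMoscovici2022, §2 ¶2 (= arXiv §3, chunk p0008:L7–L12)] -/
theorem deriv_prolateEtaFun_eq_cos_div_add (n : ℕ) {w : ℝ} (hw : w ≠ 0) :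
    deriv (prolateEtaFun n) w = ((2 * prolateFun n 1 * Real.cos (2 * π * w) / w -
      (∫ x in (-1 : ℝ)..1, (prolateFun n x + x * derivWithin (prolateFun n) (Icc (-1 : ℝ) 1) x) *
        Real.cos (2 * π * x * w)) / w : ℝ) : ℂ) := by
  set f := prolateFun n with hf
  set f₁ := derivWithin (prolateFun n) (Icc (-1 : ℝ) 1) with hf₁
  have hfc : ContinuousOn f (Icc (-1 : ℝ) 1) := (isProlateFunction_prolateFun n).contDiffOn.continuousOn
  have hf₁c : ContinuousOn f₁ (Icc (-1 : ℝ) 1) := continuousOn_derivWithin_prolateFun n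
  -- `d/dx [x f cos(2πxw)] = (f + x f₁) cos(2πxw) − 2πw x f sin(2πxw)` on `(−1, 1)`
  have hF : ∀ x ∈ Ioo (-1 : ℝ) 1, HasDerivAt (fun x ↦ x * f x * Real.cos (2 * π * x * w))
      ((f x + x * f₁ x) * Real.cos (2 * π * x * w) +
        x * f x * (-(2 * π * w) * Real.sin (2 * π * x * w))) x := by
    intro x hx
    have hc : HasDerivAt (fun x : ℝ ↦ Real.cos (2 * π * x * w))
        (-Real.sin (2 * π * x * w) * (2 * π * 1 * w)) x :=
      (((hasDerivAt_id x).const_mul (2 * π)).mul_const w).cos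
    have := ((hasDerivAt_id x).mul (hasDerivAt_prolateFun n hx)).mul hc
    refine this.congr_deriv ?_
    simp only [hf, hf₁, id, Pi.mul_apply]; ring
  have hi1 : IntervalIntegrable (fun x ↦ (f x + x * f₁ x) * Real.cos (2 * π * x * w)) volume (-1) 1 :=
    ((hfc.add (continuousOn_id.mul hf₁c)).mul (by fun_prop)).intervalIntegrable_of_Icc (by norm_num)
  have hi2 : IntervalIntegrable (fun x ↦ x * f x * (-(2 * π * w) * Real.sin (2 * π * x * w)))
      volume (-1) 1 :=
    (((continuousOn_id).mul hfc).mul (by fun_prop)).intervalIntegrable_of_Icc (by norm_num)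
  have hFTC : ∫ x in (-1 : ℝ)..1, ((f x + x * f₁ x) * Real.cos (2 * π * x * w) +
      x * f x * (-(2 * π * w) * Real.sin (2 * π * x * w))) =
      (1 : ℝ) * f 1 * Real.cos (2 * π * 1 * w) - (-1) * f (-1) * Real.cos (2 * π * (-1) * w) :=
    intervalIntegral.integral_eq_sub_of_hasDerivAt_of_le
      (f := fun x ↦ x * f x * Real.cos (2 * π * x * w)) (by norm_num : (-1 : ℝ) ≤ 1)
      ((continuousOn_id.mul hfc).mul (by fun_prop)) hF (hi1.add hi2)
  rw [intervalIntegral.integral_add hi1 hi2] at hFTC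
  have e2 : ∫ x in (-1 : ℝ)..1, x * f x * (-(2 * π * w) * Real.sin (2 * π * x * w)) =
      w * ∫ x in (-1 : ℝ)..1, f x * (-(2 * π * x) * Real.sin (2 * π * x * w)) := by
    rw [← intervalIntegral.integral_const_mul]
    refine intervalIntegral.integral_congr fun x _ ↦ ?_
    ring
  rw [e2] at hFTC
  have hb : (1 : ℝ) * f 1 * Real.cos (2 * π * 1 * w) - (-1) * f (-1) * Real.cos (2 * π * (-1) * w) =
      2 * f 1 * Real.cos (2 * π * w) := by
    rw [hf, prolateFun_neg, show 2 * π * (-1 : ℝ) * w = -(2 * π * w) by ring, Real.cos_neg,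
      show 2 * π * (1 : ℝ) * w = 2 * π * w by ring]
    ring
  rw [hb] at hFTC
  rw [(hasDerivAt_prolateEtaFun n w).deriv, ← hf]
  congr 1
  have hC : ∫ x in (-1 : ℝ)..1, f x * (-(2 * π * x) * Real.sin (2 * π * x * w)) =
      (2 * f 1 * Real.cos (2 * π * w) -
        ∫ x in (-1 : ℝ)..1, (f x + x * f₁ x) * Real.cos (2 * π * x * w)) / w := by
    rw [eq_div_iff hw]; linarith [hFTC]
  rw [hC]
  generalize (∫ x in (-1 : ℝ)..1, (f x + x * f₁ x) * Real.cos (2 * π * x * w)) = I₁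
  field_simp

/-- **The boundary Wronskian at `+∞` vanishes**: if `|g|, |g′| ≤ C/x` for `x ≥ 2` and `g` satisfies
the boundary condition (1.20) `x sin(2πx) g′ − (2πx cos(2πx) − sin(2πx)) g → 0`, then
`[η_n, g](x) → 0` as `x → +∞` (one integration by parts in `η_n`, Riemann–Lebesgue for the rest).
[cite: ConnesMoscovici2022, §1 boundary condition (1.20) (= arXiv (2.20), chunk p0006:L66–L68)] -/
theorem tendsto_wronskian_prolateEtaFun_atTop (n : ℕ) {g : ℝ → ℂ} {C : ℝ}
    (hgb : ∀ x, 2 ≤ x → ‖g x‖ ≤ C / x ∧ ‖deriv g x‖ ≤ C / x)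
    (hbc : Tendsto (bcInfEven 1 g) atTop (𝓝 0)) :
    Tendsto (wronskian 1 (prolateEtaFun n) g) atTop (𝓝 0) := by
  set A : ℝ := prolateFun n 1 with hA
  set S : ℝ → ℝ := fun w ↦ ∫ x in (-1 : ℝ)..1,
    derivWithin (prolateFun n) (Icc (-1 : ℝ) 1) x * Real.sin (2 * π * x * w) with hS
  set T : ℝ → ℝ := fun w ↦ ∫ x in (-1 : ℝ)..1,
    (prolateFun n x + x * derivWithin (prolateFun n) (Icc (-1 : ℝ) 1) x) * Real.cos (2 * π * x * w)
    with hT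
  have hS0 : Tendsto S atTop (𝓝 0) :=
    (tendsto_integral_mul_cos_sin (continuousOn_derivWithin_prolateFun n)).2
  have hT0 : Tendsto T atTop (𝓝 0) :=
    (tendsto_integral_mul_cos_sin ((isProlateFunction_prolateFun n).contDiffOn.continuousOn.add
      (continuousOn_id.mul (continuousOn_derivWithin_prolateFun n)))).1
  have hC : 0 ≤ C := by
    have := (hgb 2 le_rfl).1
    have h0 : (0 : ℝ) ≤ C / 2 := le_trans (norm_nonneg _) this
    linarith
  -- the algebraic decomposition `[η_n, g](b) = κ·BC(b) + e₁·g′(b) + e₂·g(b)`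
  have hdec : ∀ b : ℝ, b ≠ 0 → wronskian 1 (prolateEtaFun n) g b =
      ((A * (1 - b ^ 2) / (π * b ^ 2) : ℝ) : ℂ) * bcInfEven 1 g b +
      ((-(1 - b ^ 2) * S b / (2 * π * b) : ℝ) : ℂ) * deriv g b +
      (((1 - b ^ 2) * T b / b - A * (1 - b ^ 2) * Real.sin (2 * π * b) / (π * b ^ 2) : ℝ) : ℂ) *
        g b := by
    intro b hb
    have hπ : (π : ℂ) ≠ 0 := by exact_mod_cast Real.pi_ne_zero
    have hb' : (b : ℂ) ≠ 0 := by exact_mod_cast hb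
    have h1 : prolateEtaFun n b =
        ((A * Real.sin (2 * π * b) / (π * b) - S b / (2 * π * b) : ℝ) : ℂ) := by
      simpa [hA, hS] using prolateEtaFun_eq_sin_div_add n hb
    have h2 : deriv (prolateEtaFun n) b =
        ((2 * A * Real.cos (2 * π * b) / b - T b / b : ℝ) : ℂ) := by
      simpa [hA, hT] using deriv_prolateEtaFun_eq_cos_div_add n hb
    rw [wronskian, h1, h2, bcInfEven, pCoeff]
    simp only [mul_one]
    push_cast
    field_simp
    ring
  -- the norm bound for `b ≥ 2`
  have hbound : ∀ᶠ b in atTop, ‖wronskian 1 (prolateEtaFun n) g b‖ ≤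
      |A| * ‖bcInfEven 1 g b‖ + C * |S b| + (C * |T b| + |A| * C * b⁻¹) := by
    filter_upwards [eventually_ge_atTop (2 : ℝ)] with b hb
    have hb0 : 0 < b := by linarith
    have hb1 : 1 ≤ b ^ 2 := by nlinarith
    obtain ⟨hg0, hg1⟩ := hgb b hb
    rw [hdec b hb0.ne']
    have hab : |1 - b ^ 2| = b ^ 2 - 1 := by
      rw [abs_sub_comm]; exact abs_of_nonneg (by linarith)
    have hπ3 := Real.pi_gt_three
    -- |κ| ≤ |A|
    have hκ : |A * (1 - b ^ 2) / (π * b ^ 2)| ≤ |A| := by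
      rw [abs_div, abs_mul, abs_mul, abs_of_pos Real.pi_pos, abs_of_pos (by positivity : 0 < b ^ 2),
        hab, div_le_iff₀ (by positivity)]
      have h : b ^ 2 - 1 ≤ π * b ^ 2 := by nlinarith
      exact mul_le_mul_of_nonneg_left h (abs_nonneg A)
    -- |e₁| ≤ b |S b|
    have he₁ : |-(1 - b ^ 2) * S b / (2 * π * b)| ≤ b * |S b| := by
      rw [abs_div, abs_mul, abs_neg, hab, abs_of_pos (by positivity : 0 < 2 * π * b),
        div_le_iff₀ (by positivity)]
      have h : (b ^ 2 - 1) ≤ b * (2 * π * b) := by nlinarith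
      calc (b ^ 2 - 1) * |S b| ≤ (b * (2 * π * b)) * |S b| :=
            mul_le_mul_of_nonneg_right h (abs_nonneg _)
        _ = b * |S b| * (2 * π * b) := by ring
    -- |e₂| ≤ b |T b| + |A|
    have he₂ : |(1 - b ^ 2) * T b / b - A * (1 - b ^ 2) * Real.sin (2 * π * b) / (π * b ^ 2)| ≤
        b * |T b| + |A| := by
      refine (abs_sub _ _).trans (add_le_add ?_ ?_)
      · rw [abs_div, abs_mul, hab, abs_of_pos hb0, div_le_iff₀ hb0]
        have h : (b ^ 2 - 1) ≤ b * b := by nlinarith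
        calc (b ^ 2 - 1) * |T b| ≤ (b * b) * |T b| := mul_le_mul_of_nonneg_right h (abs_nonneg _)
          _ = b * |T b| * b := by ring
      · rw [abs_div, abs_mul, abs_mul, abs_mul, hab, abs_of_pos Real.pi_pos,
          abs_of_pos (by positivity : 0 < b ^ 2), div_le_iff₀ (by positivity)]
        have h1 : |A| * (b ^ 2 - 1) * |Real.sin (2 * π * b)| ≤ |A| * (b ^ 2 - 1) * 1 :=
          mul_le_mul_of_nonneg_left (Real.abs_sin_le_one _)
            (mul_nonneg (abs_nonneg A) (by linarith))
        have h2 : |A| * (b ^ 2 - 1) * 1 ≤ |A| * (π * b ^ 2) := by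
          rw [mul_one]; exact mul_le_mul_of_nonneg_left (by nlinarith) (abs_nonneg A)
        exact h1.trans h2
    refine (norm_add₃_le).trans (add_le_add_three ?_ ?_ ?_)
    · rw [norm_mul, Complex.norm_real, Real.norm_eq_abs]
      exact mul_le_mul_of_nonneg_right hκ (norm_nonneg _)
    · rw [norm_mul, Complex.norm_real, Real.norm_eq_abs]
      calc |-(1 - b ^ 2) * S b / (2 * π * b)| * ‖deriv g b‖
          ≤ (b * |S b|) * (C / b) := mul_le_mul he₁ hg1 (norm_nonneg _) (by positivity)
        _ = C * |S b| := by field_simp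
    · rw [norm_mul, Complex.norm_real, Real.norm_eq_abs]
      calc |(1 - b ^ 2) * T b / b - A * (1 - b ^ 2) * Real.sin (2 * π * b) / (π * b ^ 2)| * ‖g b‖
          ≤ (b * |T b| + |A|) * (C / b) := mul_le_mul he₂ hg0 (norm_nonneg _) (by positivity)
        _ = C * |T b| + |A| * C * b⁻¹ := by field_simp
  -- the right-hand side tends to `0`
  have hlim : Tendsto (fun b : ℝ ↦ |A| * ‖bcInfEven 1 g b‖ + C * |S b| +
      (C * |T b| + |A| * C * b⁻¹)) atTop (𝓝 0) := by
    have h1 := hbc.norm.const_mul |A|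
    have h2 := (continuous_abs.tendsto 0 |>.comp hS0).const_mul C
    have h3 := (continuous_abs.tendsto 0 |>.comp hT0).const_mul C
    have h4 := tendsto_inv_atTop_zero.const_mul (|A| * C)
    simp only [norm_zero, abs_zero, mul_zero, Function.comp_def] at h1 h2 h3 h4
    have := (h1.add h2).add (h3.add h4)
    simpa using this
  exact squeeze_zero_norm' hbound hlim

/-- **The boundary Wronskian at `1⁺` vanishes**: if `p g′ → 0` as `x → 1⁺` ((1.19)) and `g` is
differentiable on `(1, 2)`, then `[η_n, g](x) → 0` as `x → 1⁺`. [cite: ConnesMoscovici2022, §1 boundary condition (1.19) (= arXiv (2.19), chunk p0006:L59–L61)] -/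
theorem tendsto_wronskian_prolateEtaFun_one (n : ℕ) {g : ℝ → ℂ} (hgd : DifferentiableOn ℝ g (Ioo 1 2))
    (h : Tendsto (fun x ↦ pCoeff 1 x * deriv g x) (𝓝[>] (1 : ℝ)) (𝓝 0)) :
    Tendsto (wronskian 1 (prolateEtaFun n) g) (𝓝[>] (1 : ℝ)) (𝓝 0) := by
  have hη := contDiff_two_prolateEtaFun n
  have hf : Tendsto (prolateEtaFun n) (𝓝[>] (1 : ℝ)) (𝓝 (prolateEtaFun n 1)) :=
    (hη.continuous.tendsto 1).mono_left nhdsWithin_le_nhds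
  have hf' : Tendsto (deriv (prolateEtaFun n)) (𝓝[>] (1 : ℝ)) (𝓝 (deriv (prolateEtaFun n) 1)) :=
    ((hη.continuous_deriv (by norm_num)).tendsto 1).mono_left nhdsWithin_le_nhds
  -- `(x − 1) g′ → 0`, hence `(x − 1) g → 0`, hence `p g → 0`
  have h1 : Tendsto (fun x ↦ ((x - 1 : ℝ) : ℂ) * deriv g x) (𝓝[>] (1 : ℝ)) (𝓝 0) := by
    have hc : Tendsto (fun x : ℝ ↦ ((-(1 + x)⁻¹ : ℝ) : ℂ)) (𝓝[>] (1 : ℝ))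
        (𝓝 ((-(1 + 1)⁻¹ : ℝ) : ℂ)) := by
      refine (Complex.continuous_ofReal.tendsto _).comp ?_
      exact (((tendsto_const_nhds.add tendsto_id).inv₀ (by norm_num)).neg).mono_left
        nhdsWithin_le_nhds
    have h2 := h.mul hc
    rw [zero_mul] at h2
    refine h2.congr' ?_
    filter_upwards [Ioo_mem_nhdsGT (by norm_num : (1 : ℝ) < 2)] with x hx
    have hx' : (1 + x : ℂ) ≠ 0 := by
      rw [← Complex.ofReal_one, ← Complex.ofReal_add, Complex.ofReal_ne_zero]; linarith [hx.1]
    simp only [pCoeff]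
    rw [show ((1 : ℝ) ^ 2 - x ^ 2 : ℝ) = -((x - 1) * (1 + x)) by ring]
    push_cast
    field_simp
  have h2 := tendsto_sub_mul_of_deriv_right (by norm_num : (1 : ℝ) < 2) hgd h1
  have hg : Tendsto (fun x ↦ pCoeff 1 x * g x) (𝓝[>] (1 : ℝ)) (𝓝 0) := by
    have hc : Tendsto (fun x : ℝ ↦ ((-(1 + x) : ℝ) : ℂ)) (𝓝[>] (1 : ℝ)) (𝓝 ((-(1 + 1) : ℝ) : ℂ)) :=
      ((Complex.continuous_ofReal.tendsto _).comp
        (tendsto_const_nhds.add tendsto_id).neg).mono_left nhdsWithin_le_nhds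
    have h3 := hc.mul h2
    rw [mul_zero] at h3
    refine h3.congr' (Eventually.of_forall fun x ↦ ?_)
    simp only [pCoeff]; push_cast; ring
  exact tendsto_wronskian_zero hf hf' h hg


/-! ## §9 The `P̂`-half: `⟪η_n, φ⟫ = 0` for every `n`, hence `P̂_1 φ = 0`; the discharge -/

/-- The a.e.-even representative is even on `ℝ ∖ {±1}` (both sides are continuous there). [folklore] -/
private theorem repr_neg_eq {φ : L2R} {g : ℝ → ℂ} (hfg : (φ : ℝ → ℂ) =ᵐ[volume] g)
    (heven : ∀ᵐ x : ℝ, (φ : ℝ → ℂ) (-x) = (φ : ℝ → ℂ) x)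
    (hgc : ContinuousOn g {x | x ≠ 1 ∧ x ≠ -1}) {x : ℝ} (h₁ : x ≠ 1) (h₂ : x ≠ -1) :
    g (-x) = g x := by
  set S : Set ℝ := {x | x ≠ 1 ∧ x ≠ -1} with hS
  have hq : Measure.QuasiMeasurePreserving (fun x : ℝ ↦ -x) volume volume :=
    (Measure.measurePreserving_neg (volume : Measure ℝ)).quasiMeasurePreserving
  have hae : (fun x ↦ g (-x)) =ᵐ[volume] g := by
    filter_upwards [hfg, hq.ae_eq hfg, heven] with x h1 h2 h3
    simp only [Function.comp_apply] at h2
    rw [← h2, h3, h1]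
  have hmaps : MapsTo (fun x : ℝ ↦ -x) S S := fun x hx ↦
    ⟨fun h ↦ hx.2 (by linarith), fun h ↦ hx.1 (by linarith)⟩
  have hEq : EqOn (fun x ↦ g (-x)) g S :=
    Measure.eqOn_open_of_ae_eq (ae_restrict_of_ae hae) (isOpen_ne_ne 1)
      (hgc.comp continuous_neg.continuousOn hmaps) hgc
  exact hEq ⟨h₁, h₂⟩

/-- The boundary condition (1.20) for the even part `ξ⁺ = (g(x) + g(−x))/2` is the condition for `g`
itself when `g` is even off `±1`. [folklore] -/
private theorem tendsto_bcInfEven_of_evenFn {g : ℝ → ℂ}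
    (hev : ∀ x : ℝ, x ≠ 1 → x ≠ -1 → g (-x) = g x)
    (h : Tendsto (bcInfEven 1 (evenFn g)) atTop (𝓝 0)) :
    Tendsto (bcInfEven 1 g) atTop (𝓝 0) := by
  refine h.congr' ?_
  filter_upwards [eventually_gt_atTop (1 : ℝ)] with x hx
  have hS : {y : ℝ | y ≠ 1 ∧ y ≠ -1} ∈ 𝓝 x :=
    (isOpen_ne_ne 1).mem_nhds ⟨hx.ne', by linarith⟩
  have hloc : evenFn g =ᶠ[𝓝 x] g := by
    filter_upwards [hS] with y hy
    simp only [evenFn, hev y hy.1 hy.2]; ring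
  simp only [bcInfEven, hloc.deriv_eq, hloc.eq_of_nhds]

/-- `η_n · g` is integrable on `ℝ` (`η_n, φ ∈ L²`). [folklore] -/
private theorem integrable_prolateEtaFun_mul {φ : L2R} {g : ℝ → ℂ}
    (hfg : (φ : ℝ → ℂ) =ᵐ[volume] g) (n : ℕ) :
    Integrable (fun x ↦ prolateEtaFun n x * g x) := by
  refine (L2.integrable_inner (𝕜 := ℂ) (prolateEta n) φ).congr ?_
  filter_upwards [prolateEta_coeFn n, hfg] with x h1 h2
  rw [h1, h2, RCLike.inner_apply]
  simp [conj_prolateEtaFun, mul_comm]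

/-- **`∫_{(1,∞)} η_n g = 0`**: Green's formula on `[a, b] ⊂ (1, ∞)` for the pair `(η_n, g)` reads
`(χ_n − μ) ∫_a^b η_n g = [η_n, g](b) − [η_n, g](a)`; the boundary Wronskians vanish as `a → 1⁺`
((1.19)) and `b → +∞` ((1.20) and the decay of `g`), and `χ_n > 0 > μ`.
[cite: ConnesMoscovici2022, Cor 2.2 (= arXiv Cor 3.2, chunk p0008:L79–L84); §1 eqs. (1.5)–(1.6), (1.19)–(1.20)] -/
theorem setIntegral_Ioi_prolateEtaFun_mul_eq_zero {φ : L2R} (hφ : φ ∈ (prolateMax 1).domain)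
    {μ : ℝ} (hμ : μ < 0) (hW : prolateMax 1 ⟨φ, hφ⟩ = (μ : ℂ) • φ) {g : ℝ → ℂ}
    (hfg : (φ : ℝ → ℂ) =ᵐ[volume] g) (hbc : ProlateBC 1 g)
    (hbc' : Tendsto (bcInfEven 1 g) atTop (𝓝 0)) (n : ℕ) :
    ∫ x in Ioi (1 : ℝ), prolateEtaFun n x * g x = 0 := by
  set S : Set ℝ := {x | x ≠ 1 ∧ x ≠ -1} with hS
  set U : Set ℝ := Ioi (1 : ℝ) with hU
  have hUS : U ⊆ S := fun x (hx : 1 < x) ↦ ⟨hx.ne', by linarith⟩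
  have hgS : ContDiffOn ℝ ∞ g S :=
    contDiffOn_repr_of_mem_prolateMax 1 one_pos hφ hW hfg hbc.differentiableOn
  have hgU : ContDiffOn ℝ ∞ g U := hgS.mono hUS
  have hg2 : ContDiffOn ℝ 2 g U := hgU.of_le (by norm_cast)
  have hη2 : ContDiffOn ℝ 2 (prolateEtaFun n) U := (contDiff_two_prolateEtaFun n).contDiffOn
  have hode : ∀ x, 1 < x → prolateWaveOpFun 1 g x = μ * g x := fun x hx ↦
    prolateWaveOpFun_repr_eq 1 one_pos hφ hW hfg hbc.differentiableOn (hUS hx).1 (hUS hx).2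
  obtain ⟨χ, hχ⟩ := (isProlateFunction_prolateFun n).eigen
  have hχpos : 0 < χ := lt_of_le_of_lt (by positivity) ((isProlateFunction_prolateFun n).lt_eigen hχ)
  have hηode : ∀ x, prolateWaveOpFun 1 (prolateEtaFun n) x = (χ : ℂ) * prolateEtaFun n x :=
    prolateWaveOpFun_prolateEtaFun n hχ
  have hχμ : ((χ : ℂ) - μ) ≠ 0 := by
    rw [← Complex.ofReal_sub]; exact_mod_cast (by linarith : χ - μ ≠ 0)
  -- integrability
  have hHG : Integrable (fun x ↦ prolateEtaFun n x * g x) := integrable_prolateEtaFun_mul hfg n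
  have hii : ∀ a b : ℝ, IntervalIntegrable (fun x ↦ prolateEtaFun n x * g x) volume a b :=
    fun a b ↦ hHG.intervalIntegrable
  -- the primitive from `1`
  set Ψ : ℝ → ℂ := fun t ↦ ∫ x in (1 : ℝ)..t, prolateEtaFun n x * g x with hΨ
  -- Green on `[a, b] ⊂ (1, ∞)`
  have hgreen : ∀ a ∈ U, ∀ b ∈ U, ((χ : ℂ) - μ) * (Ψ b - Ψ a) =
      wronskian 1 (prolateEtaFun n) g b - wronskian 1 (prolateEtaFun n) g a := by
    intro a ha b hb
    have hsub : uIcc a b ⊆ U := by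
      rcases le_total a b with hab | hab
      · rw [uIcc_of_le hab]; exact fun x hx ↦ lt_of_lt_of_le ha hx.1
      · rw [uIcc_of_ge hab]; exact fun x hx ↦ lt_of_lt_of_le hb hx.1
    have hG := intervalIntegral_green 1 isOpen_Ioi hη2 hg2 hsub
    have hcongr : ∫ x in a..b, (g x * prolateWaveOpFun 1 (prolateEtaFun n) x -
        prolateEtaFun n x * prolateWaveOpFun 1 g x) =
        ∫ x in a..b, ((χ : ℂ) - μ) * (prolateEtaFun n x * g x) := by
      refine intervalIntegral.integral_congr fun x hx ↦ ?_
      show g x * prolateWaveOpFun 1 (prolateEtaFun n) x - prolateEtaFun n x * prolateWaveOpFun 1 g x =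
        ((χ : ℂ) - μ) * (prolateEtaFun n x * g x)
      rw [hηode x, hode x (hsub hx)]; ring
    rw [hcongr, intervalIntegral.integral_const_mul] at hG
    have hΨab : Ψ b - Ψ a = ∫ x in a..b, prolateEtaFun n x * g x := by
      simp only [hΨ]
      exact intervalIntegral.integral_interval_sub_left (hii 1 b) (hii 1 a)
    rw [hΨab, hG]
  -- boundary Wronskians
  have hSr : S ∈ 𝓝[>] (1 : ℝ) := mem_of_superset (Ioo_mem_nhdsGT (by norm_num : (1 : ℝ) < 2))
    (fun x hx ↦ hUS hx.1)
  have hbl : Tendsto (fun x ↦ pCoeff 1 x * deriv g x) (𝓝[>] (1 : ℝ)) (𝓝 0) :=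
    hbc.atLam.mono_left (nhdsWithin_le_iff.mpr hSr)
  have hw1 : Tendsto (wronskian 1 (prolateEtaFun n) g) (𝓝[>] (1 : ℝ)) (𝓝 0) :=
    tendsto_wronskian_prolateEtaFun_one n (hbc.differentiableOn.mono fun x hx ↦ hUS hx.1) hbl
  obtain ⟨C, hC⟩ := decay_of_prolateWave_eq hμ hgU hode
  have hw2 : Tendsto (wronskian 1 (prolateEtaFun n) g) atTop (𝓝 0) :=
    tendsto_wronskian_prolateEtaFun_atTop n hC hbc'
  -- limits of `Ψ`
  have hΨ1 : Tendsto Ψ (𝓝[>] (1 : ℝ)) (𝓝 0) := by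
    have hc := intervalIntegral.continuousOn_primitive_interval' (μ := volume) (hii 1 2) (a := 1)
      left_mem_uIcc
    have h := (hc 1 left_mem_uIcc).tendsto
    simp only [intervalIntegral.integral_same] at h
    refine (h.mono_left (nhdsWithin_le_iff.mpr ?_))
    rw [uIcc_of_le (by norm_num : (1 : ℝ) ≤ 2)]
    exact mem_of_superset (Ioo_mem_nhdsGT (by norm_num : (1 : ℝ) < 2)) Ioo_subset_Icc_self
  have hΨ2 : Tendsto Ψ atTop (𝓝 (∫ x in Ioi (1 : ℝ), prolateEtaFun n x * g x)) :=
    intervalIntegral_tendsto_integral_Ioi 1 hHG.integrableOn tendsto_id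
  -- `G = (χ − μ) Ψ − [η_n, g]` is constant on `(1, ∞)`
  set G : ℝ → ℂ := fun t ↦ ((χ : ℂ) - μ) * Ψ t - wronskian 1 (prolateEtaFun n) g t with hG
  have h2U : (2 : ℝ) ∈ U := by simp [hU]
  have hGconst : ∀ t ∈ U, G t = G 2 := by
    intro t ht
    have := hgreen 2 h2U t ht
    simp only [hG]
    linear_combination this
  have hG1 : Tendsto G (𝓝[>] (1 : ℝ)) (𝓝 (G 2)) := by
    refine tendsto_const_nhds.congr' ?_
    filter_upwards [Ioo_mem_nhdsGT (by norm_num : (1 : ℝ) < 2)] with t ht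
    exact (hGconst t ht.1).symm
  have hG1' : Tendsto G (𝓝[>] (1 : ℝ)) (𝓝 0) := by
    have := (hΨ1.const_mul ((χ : ℂ) - μ)).sub hw1
    rwa [mul_zero, sub_zero] at this
  have hG2 : Tendsto G atTop (𝓝 (G 2)) := by
    refine tendsto_const_nhds.congr' ?_
    filter_upwards [eventually_gt_atTop (1 : ℝ)] with t ht
    exact (hGconst t ht).symm
  have hG2' : Tendsto G atTop
      (𝓝 (((χ : ℂ) - μ) * ∫ x in Ioi (1 : ℝ), prolateEtaFun n x * g x)) := by
    have := (hΨ2.const_mul ((χ : ℂ) - μ)).sub hw2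
    rwa [sub_zero] at this
  have e1 : G 2 = 0 := tendsto_nhds_unique hG1 hG1'
  have e2 : G 2 = ((χ : ℂ) - μ) * ∫ x in Ioi (1 : ℝ), prolateEtaFun n x * g x :=
    tendsto_nhds_unique hG2 hG2'
  rw [e1] at e2
  exact (mul_eq_zero.mp e2.symm).resolve_left hχμ

/-- From `P_1 φ = 0`: the representative vanishes a.e. on `[−1, 1]`. [folklore] -/
private theorem repr_ae_zero_of_cutoffProj {φ : L2R} {g : ℝ → ℂ} (hfg : (φ : ℝ → ℂ) =ᵐ[volume] g)
    (hP : cutoffProj 1 φ = 0) : ∀ᵐ x : ℝ, x ∈ Icc (-1 : ℝ) 1 → g x = 0 := by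
  have h0 : ((cutoffProj 1 φ : L2R) : ℝ → ℂ) =ᵐ[volume] 0 := by
    rw [hP]; exact Lp.coeFn_zero _ _ _
  filter_upwards [cutoffProj_coeFn 1 φ, h0, hfg] with x h1 h2 h3 hx
  rw [h1, indicator_of_mem hx, h3] at h2
  simpa using h2

/-- **`⟪η_n, φ⟫ = 0` for every `n`**, for `φ ∈ dom W_max` even with `W_max φ = μφ`, `μ < 0`,
`P_1 φ = 0`, and boundary conditions (1.19)–(1.20) through a representative `g`.
[cite: ConnesMoscovici2022, Cor 2.2 (= arXiv Cor 3.2, chunk p0008:L79–L84)] -/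
theorem inner_prolateEta_eq_zero {φ : L2R} (hφ : φ ∈ (prolateMax 1).domain) {μ : ℝ} (hμ : μ < 0)
    (hW : prolateMax 1 ⟨φ, hφ⟩ = (μ : ℂ) • φ) {g : ℝ → ℂ} (hfg : (φ : ℝ → ℂ) =ᵐ[volume] g)
    (hbc : ProlateBC 1 g) (heven : ∀ᵐ x : ℝ, (φ : ℝ → ℂ) (-x) = (φ : ℝ → ℂ) x)
    (hP : cutoffProj 1 φ = 0) (n : ℕ) : ⟪prolateEta n, φ⟫_ℂ = 0 := by
  have hgc : ContinuousOn g {x | x ≠ 1 ∧ x ≠ -1} :=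
    (contDiffOn_repr_of_mem_prolateMax 1 one_pos hφ hW hfg hbc.differentiableOn).continuousOn
  have hev : ∀ x : ℝ, x ≠ 1 → x ≠ -1 → g (-x) = g x := fun x h₁ h₂ ↦
    repr_neg_eq hfg heven hgc h₁ h₂
  have hbc' : Tendsto (bcInfEven 1 g) atTop (𝓝 0) := tendsto_bcInfEven_of_evenFn hev hbc.evenTop
  have hI : ∫ x in Ioi (1 : ℝ), prolateEtaFun n x * g x = 0 :=
    setIntegral_Ioi_prolateEtaFun_mul_eq_zero hφ hμ hW hfg hbc hbc' n
  have hHG : Integrable (fun x ↦ prolateEtaFun n x * g x) := integrable_prolateEtaFun_mul hfg n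
  -- `⟪η_n, φ⟫ = ∫ η_n g`
  have h1 : ⟪prolateEta n, φ⟫_ℂ = ∫ x, prolateEtaFun n x * g x := by
    rw [L2.inner_def]
    refine integral_congr_ae ?_
    filter_upwards [prolateEta_coeFn n, hfg] with x ha hb
    rw [ha, hb, RCLike.inner_apply]
    simp [conj_prolateEtaFun, mul_comm]
  -- split `ℝ = (−∞, −1] ∪ (−1, 1] ∪ (1, ∞)`
  have h2 : ∫ x, prolateEtaFun n x * g x =
      (∫ x in Iic (1 : ℝ), prolateEtaFun n x * g x) + ∫ x in Ioi (1 : ℝ), prolateEtaFun n x * g x := by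
    rw [← integral_add_compl (measurableSet_Iic (a := (1 : ℝ))) hHG, compl_Iic]
  have h3 : ∫ x in Iic (1 : ℝ), prolateEtaFun n x * g x =
      (∫ x in Iic (-1 : ℝ), prolateEtaFun n x * g x) +
        ∫ x in Ioc (-1 : ℝ) 1, prolateEtaFun n x * g x := by
    rw [← Iic_union_Ioc_eq_Iic (show (-1 : ℝ) ≤ 1 by norm_num),
      setIntegral_union (disjoint_left.mpr fun x hx hx' ↦ (not_lt.mpr (mem_Iic.mp hx)) hx'.1)
        measurableSet_Ioc hHG.integrableOn hHG.integrableOn]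
  have h4 : ∫ x in Ioc (-1 : ℝ) 1, prolateEtaFun n x * g x = 0 := by
    refine integral_eq_zero_of_ae ?_
    rw [EventuallyEq, ae_restrict_iff' measurableSet_Ioc]
    filter_upwards [repr_ae_zero_of_cutoffProj hfg hP] with x hx hx'
    simp [hx (Ioc_subset_Icc_self hx')]
  have h5 : ∫ x in Iic (-1 : ℝ), prolateEtaFun n x * g x = ∫ x in Ioi (1 : ℝ), prolateEtaFun n x * g x := by
    rw [← integral_comp_neg_Ioi]
    refine setIntegral_congr_fun measurableSet_Ioi fun x (hx : 1 < x) ↦ ?_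
    show prolateEtaFun n (-x) * g (-x) = prolateEtaFun n x * g x
    rw [prolateEtaFun_neg, hev x hx.ne' (by linarith)]
  rw [h1, h2, h3, h4, h5, hI]; simp

/-- **Cor 2.2, `P̂`-half: `P̂_1 φ = 0`** — an even eigenfunction of `W_sa` (`λ = 1`) with negative
eigenvalue has Fourier transform vanishing on `[−1, 1]`: it is orthogonal to every `η_n = 𝓕⁻¹ξ_n`
(`inner_prolateEta_eq_zero`), so `𝓕φ ⟂ ξ_n`, and the `ξ_n` are complete in the even part of the
range of `P_1`. RH-FREE. [cite: ConnesMoscovici2022, Cor 2.2 (= arXiv:2112.05500 Cor 3.2, chunk p0008:L79–L84)] -/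
theorem cutoffProjHat_eq_zero_of_hasEigenvector {W : L2R →ₗ.[ℂ] L2R} (hSA : IsProlateSA 1 W)
    {μ : ℝ} (hμ : μ < 0) {φ : L2R} (hev : W.HasEigenvector (μ : ℂ) φ)
    (heven : ∀ᵐ x : ℝ, (φ : ℝ → ℂ) (-x) = (φ : ℝ → ℂ) x) : cutoffProjHat 1 φ = 0 := by
  obtain ⟨hφ, hW, g, hfg, hbc⟩ := exists_repr_of_hasEigenvector hSA hev
  have hP : cutoffProj 1 φ = 0 := cutoffProj_eq_zero_of_hasEigenvector hSA hμ hev heven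
  have hperp : ∀ n, ⟪prolateXi n, (𝓕 φ : L2R)⟫_ℂ = 0 := fun n ↦ by
    rw [← fourier_prolateEta n, Lp.inner_fourier_eq]
    exact inner_prolateEta_eq_zero hφ hμ hW hfg hbc heven hP n
  have hevφ : φ ∈ evenPart := mem_evenPart_iff.mpr heven
  have hzero : cutoffProj 1 (𝓕 φ : L2R) = 0 := by
    refine CC2021_sec4_xi_complete_holds (cutoffProj 1 (𝓕 φ : L2R))
      (cutoffProj_mem_evenPart 1 (fourier_mem_evenPart hevφ)) ?_ ?_
    · show cutoffProj 1 (cutoffProj 1 (𝓕 φ : L2R)) = cutoffProj 1 (𝓕 φ : L2R)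
      exact congrFun (congrArg DFunLike.coe (cutoffProj_idem 1).eq) (𝓕 φ : L2R)
    · intro n
      have hsym := ContinuousLinearMap.isSelfAdjoint_iff_isSymmetric.mp (cutoffProj_isSelfAdjoint 1)
      have h := hsym (prolateXi n) (𝓕 φ : L2R)
      simp only [ContinuousLinearMap.coe_coe] at h
      rw [← h, cutoffProj_prolateXi]
      exact hperp n
  rw [cutoffProjHat_apply, hzero]
  exact map_zero (Lp.fourierTransformₗᵢ ℝ ℂ).symm

/-! ## §10 Discharge of the named fact -/

/-- **Discharge** of the named fact `CM22_cor_2_2` (RH-FREE, PROVED): **Corollary 2.2** (= arXiv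
Corollary 3.2) of Connes–Moscovici — "assume `μ` is a negative eigenvalue. Then `φ_μ` belongs to the
Sonin space" — typed on the eigenvector: every a.e.-even eigenvector of `W_sa` (`λ = 1`) with negative
eigenvalue lies in `soninSpace 1 1`.  Route (elementary, behind the printed remark "Sonin's space is the
orthogonal of the eigenspaces of `W_sa` associated to the classical prolate functions and their Fourier
transforms"): interior elliptic regularity of the boundary-condition representative, Green's formula
against `ξ_n` on `(−1, 1)` and against `η_n = 𝓕ξ_n` on `(1, ∞)` with the boundary conditions
(1.19)–(1.20) killing the Wronskians, positivity `χ_n > 0 > μ` of the classical prolate eigenvalues,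
and completeness of the `ξ_n` (`CC2021_sec4_xi_complete_holds`).
[cite: ConnesMoscovici2022, Cor 2.2 (= arXiv:2112.05500 Cor 3.2, chunk p0008:L79–L84)] -/
theorem CM22_cor_2_2_holds : CM22_cor_2_2 := fun _ hSA _ hμ _ hev heven ↦
  mem_soninSpace_iff_cutoffProj.mpr ⟨mem_evenPart_iff.mpr heven,
    cutoffProj_eq_zero_of_hasEigenvector hSA hμ hev heven,
    cutoffProjHat_eq_zero_of_hasEigenvector hSA hμ hev heven⟩

end Literature.NumberTheory.ConnesMoscovici2022
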